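import Literature.Probability.Process.FrozenLocalMartingale
import Literature.Probability.RandomPlanarGeometry.ImaginaryGeometryRegular
import Literature.Probability.RandomPlanarGeometry.LoewnerAliveMargin
import Literature.Probability.RandomPlanarGeometry.LoewnerTube
import Literature.Probability.RandomPlanarGeometry.SLEKappaRhoCellMartingale
import Literature.Probability.RandomPlanarGeometry.SLEKappaRhoLemma810
import Literature.Probability.RandomPlanarGeometry.SLEKappaRhoMartingaleReduction
import Literature.Probability.RandomPlanarGeometry.SLEKappaRhoOneStepBounds
import Literature.Probability.RandomPlanarGeometry.SLEKappaRhoSchemeProcesses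
import Literature.Probability.RandomPlanarGeometry.SLEKappaRhoSchemeStopping
import HarnessLib

/-!
# [LSW] Lemma 8.9 for SLE(8/3, ρ): from the one-step expansion to the martingale extension of `M_t`

G. F. Lawler, O. Schramm, W. Werner, *Conformal restriction: the chordal case*, J. Amer. Math.
Soc. **16** (2003) 917–955 (**[LSW]**), §8.4: Lemma 8.9 ("`(M_t, t < T)` is a local
martingale"), with Lemma 8.10 and the convergence clause of the end of the proof of Thm. 8.4. This
file assembles the stochastic-calculus-free proof of the tree's leaf
`SLEKappaRho.exists_isOneSidedMartingale` in four parts (each with its own summary below):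

1. the one-step expansion of `M_t` ALONG A SAMPLE PATH of the scheme processes
   (`oneStep_pathwise`, from the deterministic `oneSidedM_slidHull_expansion`);
2. the bounds up to `τ_k` and the right-continuity of `t ↦ M_t` at controlled times
   (`bound_of_le_tauK`, `rightCts_Yc`);
3. the cell scheme of level `k` (`cellScheme_level`) — hence `Y^{τ_k}` is a martingale of the
   Brownian filtration (`SLEKappaRho.CellScheme.martingale_stoppedProcess`);
4. the exhaustion `τ_k ↑ ≥ T_A` on good paths and the frozen limit: the martingale extension
   `SLEKappaRho.exists_isMartingaleExtension`.

No named facts.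
-/

/-!
## [LSW] Lemma 8.9 for SLE(8/3, ρ): the one-step expansion of `M_t` along a sample path

G. F. Lawler, O. Schramm, W. Werner, *Conformal restriction: the chordal case*, J. Amer. Math.
Soc. **16** (2003) 917–955 (**[LSW]**), §8.4, proof of Lemma 8.9 ("plugging in the explicit
choice of `b, c` and `d[h_t(W_t)], …` into Itô's formula for `dM_t` proves the lemma"). Here the
deterministic one-step expansion `oneSidedM_slidHull_expansion` (`SLEKappaRhoOneStepBounds`) is
applied ALONG A SAMPLE PATH of the scheme processes of `SLEKappaRhoSchemeProcesses`: from a base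
time `t₁ ≤ τ_k` (where the controls of `SLEKappaRhoSchemeStopping` hold) over a short step to
`t₂`, provided the synthetic pair `(W, I)` is consistent with the force-point geometry at both
ends (`Z = W + 2I ≥ 0`, so `o = −Z`; this holds on the good paths, and near base points with
`Z > 0`):

* the constants `rho0K, deltaK, etaK, c0K, KstepK` of level `k` (depending on `A, ρ, k` only);
* `alive_and_hull_of_step` — over such a step `A` stays alive and the slid hull at `t₂` is the
  one-step image of the slid hull at `t₁` (`Loewner.disjoint_closedHull_add_of_margin`,
  `Loewner.slidHull_add`), `M ∈ [0, 1]` at both ends (Lemma 8.10, `oneSidedM_bounds_of_isArcHull`);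
* `oneStep_pathwise` — **the one-step inequality of `SLEKappaRho.OneStepPath` for the scheme
  processes** with constant `KstepK` and threshold `c0K`.

No named facts.
-/

noncomputable section

open Set Filter Metric Function MeasureTheory
open _root_.Complex _root_.Topology
open UpperHalfPlane (upperHalfPlaneSet)
open scoped NNReal ENNReal
open Literature.Probability.Process

namespace Literature.Probability.RandomPlanarGeometry

namespace SLEKappaRho

open Loewner

variable {J : ℝ≥0 → (ℝ≥0 → ℝ) → ℝ} {ρ : ℝ} {A : Set ℂ}

/-! ### The constants of level `k` -/

/-- `ρ₀ = ℓ_k/8` (so that `B(0, 8ρ₀) = B(0, ℓ_k)` misses the slid hull). [folklore] -/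
def rho0K (A : Set ℂ) (k : ℕ) : ℝ := lvl A k / 8

/-- `δ = ℓ_k/2`. [folklore] -/
def deltaK (A : Set ℂ) (k : ℕ) : ℝ := lvl A k / 2

/-- `η = min (ℓ_k (ℓ_k/8)/320) 1`. [folklore] -/
def etaK (A : Set ℂ) (k : ℕ) : ℝ := min (lvl A k * (lvl A k / 8) / 320) 1

/-- The drift bound `M_g`. [folklore] -/
def MgK (A : Set ℂ) (k : ℕ) : ℝ := glueDriftBound (rho0K A k) (deltaK A k)

/-- The absorbed constant `C₁` of the expansion. [folklore] -/
def C1K (A : Set ℂ) (ρ : ℝ) (k : ℕ) : ℝ :=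
  absorbC₁ (ellBound ρ (deltaK A k)) (lamBound ρ (deltaK A k) (etaK A k) (MgK A k)) (kbc ρ) (deltaK A k) (etaK A k)
    (MgK A k) (errP (lvl A k) (deltaK A k) (etaK A k) (rho0K A k)) (errQ (lvl A k) (deltaK A k) (etaK A k) (rho0K A k))

/-- The master smallness parameter `m_k ∈ (0, 1]`. [folklore] -/
def mK (A : Set ℂ) (ρ : ℝ) (k : ℕ) : ℝ :=
  min 1 (min (lvl A k ^ 2 / 8000) (min (etaK A k / 16)
    (min (deltaK A k / 2 / (16 * MgK A k / etaK A k + errP (lvl A k) (deltaK A k) (etaK A k) (rho0K A k) +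
        errQ (lvl A k) (deltaK A k) (etaK A k) (rho0K A k) + 1))
      (min (1 / (C1K A ρ k + 1)) (lvl A k ^ 2 / 16)))))

/-- **The step threshold `c₀ = (m_k/8)²`.** [folklore] -/
def c0K (A : Set ℂ) (ρ : ℝ) (k : ℕ) : ℝ := (mK A ρ k / 8) ^ 2

/-- **The one-step constant of level `k`.** [folklore] -/
def KstepK (A : Set ℂ) (ρ : ℝ) (k : ℕ) : ℝ := oneStepK ρ (deltaK A k) (etaK A k) (rho0K A k) (lvl A k)

section Constants

variable (hA : IsPlusHull A) (hne : Set.Nonempty A)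
include hA hne

/-- Positivity of the basic constants. [folklore] -/
theorem consts_pos (k : ℕ) : 0 < lvl A k ∧ 0 < rho0K A k ∧ 0 < deltaK A k ∧ 0 < etaK A k ∧ etaK A k ≤ 1 ∧ 0 < MgK A k := by
  have hℓ := (lvl_pos_le hA hne k).1
  refine ⟨hℓ, by unfold rho0K; positivity, by unfold deltaK; positivity, lt_min (by positivity) one_pos, min_le_right _ _, ?_⟩
  unfold MgK glueDriftBound rho0K deltaK
  positivity

/-- Nonnegativity of the error constants. [folklore] -/
theorem errs_nonneg (ρ : ℝ) (k : ℕ) :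
    0 ≤ errP (lvl A k) (deltaK A k) (etaK A k) (rho0K A k) ∧ 0 ≤ errQ (lvl A k) (deltaK A k) (etaK A k) (rho0K A k) ∧
      0 ≤ C1K A ρ k := by
  obtain ⟨hℓ, hρ₀, hδ, hη, -, hMg⟩ := consts_pos hA hne k
  have hP := errP_nonneg hℓ hδ hη hρ₀
  have hQ := errQ_nonneg hℓ hδ hη hρ₀
  refine ⟨hP, hQ, ?_⟩
  unfold C1K
  exact absorbC₁_nonneg (ellBound_pos ρ _).le (lamBound_nonneg ρ hδ hη hMg.le) (kbc_pos ρ).le hδ hη hP hQ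

/-- `0 < m_k ≤ 1` and the bounds encoded in `m_k`. [folklore] -/
theorem mK_pos_le (ρ : ℝ) (k : ℕ) :
    0 < mK A ρ k ∧ mK A ρ k ≤ 1 ∧ mK A ρ k ≤ lvl A k ^ 2 / 8000 ∧ mK A ρ k ≤ etaK A k / 16 ∧
      mK A ρ k ≤ deltaK A k / 2 / (16 * MgK A k / etaK A k + errP (lvl A k) (deltaK A k) (etaK A k) (rho0K A k) +
        errQ (lvl A k) (deltaK A k) (etaK A k) (rho0K A k) + 1) ∧
      mK A ρ k ≤ 1 / (C1K A ρ k + 1) ∧ mK A ρ k ≤ lvl A k ^ 2 / 16 := by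
  obtain ⟨hℓ, hρ₀, hδ, hη, -, hMg⟩ := consts_pos hA hne k
  obtain ⟨hP, hQ, hC1⟩ := errs_nonneg hA hne ρ k
  refine ⟨?_, min_le_left _ _, ?_, ?_, ?_, ?_, ?_⟩
  · unfold mK; positivity
  · exact (min_le_right _ _).trans (min_le_left _ _)
  · exact (min_le_right _ _).trans ((min_le_right _ _).trans (min_le_left _ _))
  · exact (min_le_right _ _).trans ((min_le_right _ _).trans ((min_le_right _ _).trans (min_le_left _ _)))
  · exact (min_le_right _ _).trans ((min_le_right _ _).trans ((min_le_right _ _).trans ((min_le_right _ _).trans (min_le_left _ _))))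
  · exact (min_le_right _ _).trans ((min_le_right _ _).trans ((min_le_right _ _).trans ((min_le_right _ _).trans (min_le_right _ _))))

/-- `0 < c₀ ≤ m_k/64 ≤ 1/64` and `√c₀ = m_k/8`. [folklore] -/
theorem c0K_pos_le (ρ : ℝ) (k : ℕ) :
    0 < c0K A ρ k ∧ c0K A ρ k ≤ mK A ρ k / 64 ∧ c0K A ρ k ≤ 1 / 64 ∧ Real.sqrt (c0K A ρ k) = mK A ρ k / 8 := by
  obtain ⟨hm0, hm1, -⟩ := mK_pos_le hA hne ρ k
  refine ⟨by unfold c0K; positivity, ?_, ?_, ?_⟩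
  · unfold c0K; nlinarith
  · unfold c0K; nlinarith
  · unfold c0K; exact Real.sqrt_sq (by positivity)

/-- `0 ≤ KstepK`. [folklore] -/
theorem KstepK_nonneg (ρ : ℝ) (k : ℕ) : 0 ≤ KstepK A ρ k := by
  obtain ⟨hℓ, hρ₀, hδ, hη, -, hMg⟩ := consts_pos hA hne k
  obtain ⟨hP, hQ, -⟩ := errs_nonneg hA hne ρ k
  unfold KstepK oneStepK
  have hK := absorbK_nonneg (ellBound_pos ρ (deltaK A k)).le (lamBound_nonneg ρ hδ hη hMg.le) (kbc_pos ρ).le hδ hη hP hQ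
    (Mg := MgK A k)
  unfold MgK at hK
  positivity

end Constants

/-! ### Arithmetic of the smallness conditions -/

/-- First smallness condition from `u ≤ (δ/2)/(16M_g/η + P + Q + 1)`. [folklore] -/
theorem smallness₁ {u Mg P Q η δ s : ℝ} (hu0 : 0 ≤ u) (hu1 : u ≤ 1) (hP : 0 ≤ P) (hQ : 0 ≤ Q) (hMg : 0 ≤ Mg) (hη : 0 < η)
    (hs1 : s ≤ 1) (hT : u ≤ δ / 2 / (16 * Mg / η + P + Q + 1)) :
    16 * u * Mg / η + u * (P * s + Q * u) ≤ δ / 2 := by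
  have hden : 0 < 16 * Mg / η + P + Q + 1 := by positivity
  have e1 : P * s ≤ P := mul_le_of_le_one_right hP hs1
  have e2 : Q * u ≤ Q := mul_le_of_le_one_right hQ hu1
  have h1 : 16 * u * Mg / η + u * (P * s + Q * u) ≤ u * (16 * Mg / η + P + Q + 1) := by
    have : u * (P * s + Q * u) ≤ u * (P + Q + 1) := mul_le_mul_of_nonneg_left (by linarith) hu0
    have e3 : 16 * u * Mg / η = u * (16 * Mg / η) := by ring
    rw [e3]
    have e4 : u * (16 * Mg / η) + u * (P + Q + 1) = u * (16 * Mg / η + P + Q + 1) := by ring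
    linarith
  calc _ ≤ u * (16 * Mg / η + P + Q + 1) := h1
    _ ≤ δ / 2 / (16 * Mg / η + P + Q + 1) * (16 * Mg / η + P + Q + 1) := mul_le_mul_of_nonneg_right hT hden.le
    _ = δ / 2 := div_mul_cancel₀ _ hden.ne'

/-- Second smallness condition from `s + A + u ≤ m ≤ 1/(C + 1)`. [folklore] -/
theorem smallness₂ {C s A u m : ℝ} (hC : 0 ≤ C) (hsum : s + A + u ≤ m) (hm : m ≤ 1 / (C + 1)) : C * (s + A + u) ≤ 1 := by
  have hden : 0 < C + 1 := by linarith
  calc C * (s + A + u) ≤ C * m := mul_le_mul_of_nonneg_left hsum hC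
    _ ≤ C * (1 / (C + 1)) := mul_le_mul_of_nonneg_left hm hC
    _ ≤ 1 := by rw [mul_one_div, div_le_one hden]; linarith

/-- The step-size bookkeeping: with `√c₀ = m/8`, `u, S ≤ c₀ ≤ m/64` one has `S + 4√u ≤ 5m/8`.
[folklore] -/
theorem stepSize_le_of_small {S m c₀ : ℝ} {u : ℝ≥0} (hsqrt : Real.sqrt c₀ = m / 8) (hcm : c₀ ≤ m / 64)
    (hu : (u : ℝ) ≤ c₀) (hS : S ≤ c₀) : stepSize S u ≤ 5 * m / 8 := by
  rw [stepSize]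
  have hsu : Real.sqrt u ≤ m / 8 := by rw [← hsqrt]; exact Real.sqrt_le_sqrt hu
  have hm0 : 0 ≤ m / 8 := hsqrt ▸ Real.sqrt_nonneg _
  linarith

/-! ### One step along a sample path -/

section Step

variable (hAs : IsSmoothHull A) (hA : IsPlusHull A) (hne : Set.Nonempty A) (hρ : -2 < ρ)
  {k : ℕ} {t₁ t₂ : ℝ≥0} {ω : ℝ≥0 → ℝ} {S : ℝ}
  (hτ : (t₁ : WithTop ℝ≥0) ≤ tauK J ρ hA hne k ω) (h12 : t₁ < t₂) (hh : (t₂ : ℝ) - t₁ ≤ c0K A ρ k)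
  (hW : ∀ r, t₁ ≤ r → r ≤ t₂ → |drvC J ρ (lvlN k) r ω - drvC J ρ (lvlN k) t₁ ω| ≤ S) (hSc : S ≤ c0K A ρ k)

include hAs hA hne hτ h12 hh hW hSc in
/-- **Over a short step from a controlled base time `A` stays alive, the slid hull propagates by the
cocycle, and `M ∈ [0, 1]` at both ends.** [folklore] -/
theorem alive_and_hull_of_step (hρ : -2 < ρ) :
    ω ∈ aliveEv J ρ A (lvlN k) t₁ ∧ ω ∈ aliveEv J ρ A (lvlN k) t₂ ∧
      hullC J ρ A (lvlN k) t₂ ω =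
        slidHull (fun r ↦ drvC J ρ (lvlN k) (t₁ + r) ω - drvC J ρ (lvlN k) t₁ ω) (hullC J ρ A (lvlN k) t₁ ω) (t₂ - t₁) ∧
      Mraw J ρ A (lvlN k) t₁ ω ∈ Icc (0 : ℝ) 1 ∧ Mraw J ρ A (lvlN k) t₂ ω ∈ Icc (0 : ℝ) 1 := by
  obtain ⟨halive₁, -, -, hball, -, -⟩ := geometry_of_le_tauK hτ
  have hℓ := (lvl_pos_le hA hne k).1
  have hℓ1 := (lvl_pos_le hA hne k).2.2.2
  obtain ⟨hm0, hm1, -, -, -, -, hmℓ⟩ := mK_pos_le hA hne ρ k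
  obtain ⟨hc0, hcm, hc8, -⟩ := c0K_pos_le hA hne ρ k
  set W : ℝ≥0 → ℝ := drvPath J ρ (lvlN k) ω with hWdef
  have hWc : Continuous W := continuous_drvPath ω
  have hW0 : W 0 = 0 := drvPath_zero ω
  set u : ℝ≥0 := t₂ - t₁ with hu
  have htu : t₁ + u = t₂ := add_tsub_cancel_of_le h12.le
  -- alive at `t₂` by the margin lemma
  have hms : ∀ a ∈ A, lvl A k ≤ ‖map W t₁ a - W t₁‖ := by
    intro a ha
    have hmem : map W t₁ a - W t₁ ∈ slidHull W A t₁ := mem_slidHull_iff.2 ⟨a, ha, rfl⟩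
    by_contra hlt
    push Not at hlt
    exact Set.disjoint_left.1 hball (mem_ball_zero_iff.2 hlt) hmem
  have hΩ : ∀ r : ℝ≥0, t₁ ≤ r → r ≤ t₁ + u → |W r - W t₁| ≤ S := fun r hr1 hr2 ↦ hW r hr1 (by rw [htu] at hr2; exact hr2)
  have hcℓ : c0K A ρ k ≤ lvl A k ^ 2 / 16 := hcm.trans ((by linarith : mK A ρ k / 64 ≤ mK A ρ k).trans hmℓ)
  have hsmall : 4 * (u : ℝ) / lvl A k + S < lvl A k / 2 := by
    have hu' : (u : ℝ) ≤ lvl A k ^ 2 / 16 := by rw [hu, NNReal.coe_sub h12.le]; exact hh.trans hcℓ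
    have hS' : S ≤ lvl A k ^ 2 / 16 := hSc.trans hcℓ
    have h1 : 4 * (u : ℝ) / lvl A k ≤ lvl A k / 4 := by
      rw [div_le_iff₀ hℓ]; nlinarith
    nlinarith
  have halive₂' : Disjoint (closedHull W (t₁ + u)) A :=
    disjoint_closedHull_add_of_margin hWc hA.1.isBoundedHull.subset_closure halive₁ hℓ hms hΩ hsmall
  have halive₂ : ω ∈ aliveEv J ρ A (lvlN k) t₂ := by rw [mem_aliveEv_iff, ← htu]; exact halive₂'
  -- the cocycle
  have hcoc : hullC J ρ A (lvlN k) t₂ ω = slidHull (fun r ↦ W (t₁ + r) - W t₁) (hullC J ρ A (lvlN k) t₁ ω) u := by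
    rw [hullC, hullC, ← htu]
    exact slidHull_add hWc fun a ha ↦ lt_swallowingTime_of_alive hA.1 halive₂' ha
  -- `M ∈ [0,1]` by Lemma 8.10
  have hM : ∀ t, ω ∈ aliveEv J ρ A (lvlN k) t → Mraw J ρ A (lvlN k) t ω ∈ Icc (0 : ℝ) 1 := by
    intro t ht
    have hBp : IsPlusHull (hullC J ρ A (lvlN k) t ω) := isPlusHull_hullC hA ht
    have hBa : IsArcHull (hullC J ρ A (lvlN k) t ω) := isArcHull_slidHull_of_disjoint hWc hAs.isArcHull hA.1.zero_notMem ht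
    obtain ⟨hlow, hup⟩ := oneSidedM_bounds_of_isArcHull hρ hBa hBp (oposC_nonpos (J := J) (ρ := ρ) (c := lvlN k) t ω)
    rw [(jets_of_mem ht 0).2.2.2.2]
    obtain ⟨hd0, hd1, -⟩ := starDeriv_spec hBp.1
    rw [hullDeriv_eq_starDeriv] at hlow hup
    exact ⟨(Real.rpow_nonneg hd0.le _).trans hlow, hup.trans (Real.rpow_le_one hd0.le hd1 (exponent_min_pos hρ).le)⟩
  exact ⟨halive₁, halive₂, hcoc, hM t₁ halive₁, hM t₂ halive₂⟩

set_option maxHeartbeats 800000 in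
include hAs hA hne hτ h12 hh hW hSc in
/-- **The one-step inequality along a sample path** (`OneStepPath` for the scheme processes of level
`k`): from a controlled base time `t₁ ≤ τ_k`, over a step with `t₂ − t₁, S, ΔI ≤ c₀` and with
`Z = W + 2I ≥ 0` at both ends,
`|Y_{t₂} − Y_{t₁} − Y_{t₁}(ℓ₁ x + m₁ a + ½(ℓ₂ + ℓ₁²) x² + h λ)| ≤ K · cellPoly(|x|, |a|, h, S + 4√h)`.
[cite: LawlerSchrammWerner2003Restriction, Lemma 8.9 and its proof (§8.4)] -/
theorem oneStep_pathwise (hρ : -2 < ρ)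
    (hI : clockTrunc J (lvlN k) t₂ ω - clockTrunc J (lvlN k) t₁ ω ≤ c0K A ρ k)
    (hZ1 : 0 ≤ drvC J ρ (lvlN k) t₁ ω + 2 * clockTrunc J (lvlN k) t₁ ω)
    (hZ2 : 0 ≤ drvC J ρ (lvlN k) t₂ ω + 2 * clockTrunc J (lvlN k) t₂ ω) :
    ‖((Yc J ρ A (lvlN k) t₂ ω : ℝ) : ℂ) - Yc J ρ A (lvlN k) t₁ ω - Yc J ρ A (lvlN k) t₁ ω *
        (jL1 J ρ A (lvlN k) t₁ ω * ((drvC J ρ (lvlN k) t₂ ω - drvC J ρ (lvlN k) t₁ ω : ℝ) : ℂ) +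
          jM1 J ρ A (lvlN k) t₁ ω * ((-2 * (clockTrunc J (lvlN k) t₂ ω - clockTrunc J (lvlN k) t₁ ω) : ℝ) : ℂ) +
          2⁻¹ * (jL2 J ρ A (lvlN k) t₁ ω + jL1 J ρ A (lvlN k) t₁ ω ^ 2) *
            ((drvC J ρ (lvlN k) t₂ ω - drvC J ρ (lvlN k) t₁ ω : ℝ) : ℂ) ^ 2 +
          (((t₂ : ℝ) - t₁ : ℝ) : ℂ) * jLam J ρ A (lvlN k) (rho0K A k) t₁ ω)‖ ≤
      KstepK A ρ k * cellPoly |drvC J ρ (lvlN k) t₂ ω - drvC J ρ (lvlN k) t₁ ω|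
        (2 * (clockTrunc J (lvlN k) t₂ ω - clockTrunc J (lvlN k) t₁ ω)) ((t₂ : ℝ) - t₁) (S + 4 * Real.sqrt ((t₂ : ℝ) - t₁)) := by
  obtain ⟨halive₁, halive₂, hcoc, hM₁, hM₂⟩ := alive_and_hull_of_step hAs hA hne hτ h12 hh hW hSc hρ
  obtain ⟨-, hd, hclear, hball, -, habso⟩ := geometry_of_le_tauK hτ
  have hJet := jetControl_of_le_tauK (J := J) (ρ := ρ) hAs hτ
  obtain ⟨hℓ, hρ₀, hδ, hη, hη1, hMg⟩ := consts_pos hA hne k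
  obtain ⟨hP, hQ, hC1⟩ := errs_nonneg hA hne ρ k
  obtain ⟨hm0, hm1, hm8000, hmη, hmT5, hmC1, hmℓ⟩ := mK_pos_le hA hne ρ k
  obtain ⟨hc0, hcm, hc8, hsqrt⟩ := c0K_pos_le hA hne ρ k
  -- names
  set c := lvlN k with hc
  set ℓ := lvl A k with hℓdef
  set m := mK A ρ k with hmdef
  set B := hullC J ρ A c t₁ ω with hBdef
  set o := oposC J ρ c t₁ ω with hodef
  set u : ℝ≥0 := t₂ - t₁ with hudef
  set U : ℝ≥0 → ℝ := fun r ↦ drvC J ρ c (t₁ + r) ω - drvC J ρ c t₁ ω with hUdef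
  set ΔI := clockTrunc J c t₂ ω - clockTrunc J c t₁ ω with hΔI
  set a : ℝ := -2 * ΔI with hadef
  have htu : t₁ + u = t₂ := add_tsub_cancel_of_le h12.le
  have hucoe : ((u : ℝ≥0) : ℝ) = (t₂ : ℝ) - t₁ := by rw [hudef, NNReal.coe_sub h12.le]
  have hu : 0 < u := tsub_pos_of_lt h12
  have hu0 : (0 : ℝ) ≤ u := u.coe_nonneg
  have hu1 : (u : ℝ) ≤ 1 := by rw [hucoe]; linarith
  -- the hull at the base time
  have hBp : IsPlusHull B := isPlusHull_hullC hA halive₁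
  have hρ₀eq : 8 * rho0K A k = ℓ := by rw [rho0K]; ring
  have hBρ : Disjoint (ball (0 : ℂ) (8 * rho0K A k)) B := by rw [hρ₀eq]; exact hball
  have hclear' : ∀ t : ℝ, t ∈ Icc (-(3 * (k : ℝ)) - 2) 0 → rho0K A k / 8 ≤ |t| → Disjoint (ball (t : ℂ) (rho0K A k)) B := by
    intro t ht _
    have h := hclear (t : ℂ) ⟨t, ht.2, rfl⟩
    exact h.mono_left (ball_subset_ball (by rw [rho0K]; linarith))
  -- the driver increment
  have hUc : Continuous U := ((continuous_drvPath ω).comp (continuous_const.add continuous_id)).sub continuous_const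
  have hU0 : U 0 = 0 := by simp [hUdef]
  have hSU : ∀ v : ℝ≥0, v ≤ u → |U v| ≤ S := fun v hv ↦
    hW (t₁ + v) le_self_add (by rw [← htu]; exact add_le_add le_rfl hv)
  have hS0 : 0 ≤ S := by have := hSU 0 bot_le; rw [hU0, abs_zero] at this; exact this
  -- the step size
  have hstep_le : stepSize S u ≤ 5 * m / 8 := stepSize_le_of_small hsqrt hcm (by rw [hucoe]; exact hh) hSc
  have hstep1 : stepSize S u ≤ 1 := by linarith
  have hηs : stepSize S u ≤ ℓ * rho0K A k / 1000 := by
    rw [rho0K]; have : ℓ * (ℓ / 8) / 1000 = ℓ ^ 2 / 8000 := by ring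
    rw [this]; linarith
  have hmcond : 8 * stepSize S u ≤ deltaK A k * rho0K A k / 16 := by
    rw [deltaK, rho0K]; have : ℓ / 2 * (ℓ / 8) / 16 = ℓ ^ 2 / 256 := by ring
    rw [this]; nlinarith
  have hηsη : stepSize S u < etaK A k / 8 := by linarith
  -- `o`, `a`, `o'`
  have hZ₁ : o = -(drvC J ρ c t₁ ω + 2 * clockTrunc J c t₁ ω) := by
    rw [hodef, oposC]; exact min_eq_left (by linarith)
  have hoI : o ∈ Icc (-(3 * (k : ℝ))) 0 := by
    refine ⟨?_, oposC_nonpos t₁ ω⟩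
    have := habso; rw [abs_le] at this; exact this.1
  have hΔI0 : 0 ≤ ΔI := sub_nonneg.2 (monotone_clockTrunc c ω h12.le)
  have ha0 : a ≤ 0 := by rw [hadef]; linarith
  have haabs : |a| = 2 * ΔI := by rw [hadef, abs_of_nonpos ha0]; ring
  have haη : |a| < etaK A k / 8 := by
    rw [haabs]
    have : 2 * ΔI ≤ 2 * c0K A ρ k := by linarith
    have h2 : 2 * c0K A ρ k ≤ m / 4 := by linarith
    linarith
  have hUu : U u = drvC J ρ c t₂ ω - drvC J ρ c t₁ ω := by simp only [hUdef, htu]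
  have ho' : o + a - U u = oposC J ρ c t₂ ω := by
    rw [hZ₁, hadef, hΔI, hUu, oposC, min_eq_left (by linarith)]; ring
  have ho'0 : o + a - U u ≤ 0 := by rw [ho']; exact oposC_nonpos t₂ ω
  -- the smallness conditions
  have hucₒ : (u : ℝ) ≤ c0K A ρ k := by rw [hucoe]; exact hh
  have hsm₁ : 16 * u * glueDriftBound (rho0K A k) (deltaK A k) / etaK A k +
      u * (errP ℓ (deltaK A k) (etaK A k) (rho0K A k) * stepSize S u + errQ ℓ (deltaK A k) (etaK A k) (rho0K A k) * u) ≤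
        deltaK A k / 2 :=
    smallness₁ hu0 hu1 hP hQ hMg.le hη hstep1 (hucₒ.trans ((hcm.trans (by linarith)).trans hmT5))
  have hsm₂ : C1K A ρ k * (stepSize S u + |a| + u) ≤ 1 := by
    refine smallness₂ hC1 ?_ hmC1
    rw [haabs]
    have e1 : 2 * ΔI ≤ m / 32 := by linarith
    have e2 : (u : ℝ) ≤ m / 64 := hucₒ.trans hcm
    linarith
  -- the expansion
  have hexp := oneSidedM_slidHull_expansion (hB := hBp) (hρ₀ := hρ₀) (hBρ := hBρ) (hJ := hJet) (hU := hUc) (hU0 := hU0)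
    (hu := hu) (hS := hSU) (hdmin := hℓ) (hdminB := hd) (hηs := hηs) (hm := hmcond) (hηsη := hηsη) (hu1 := hu1)
    (hclear := hclear') ρ (o := o) (a := a) ⟨hoI.1, hoI.2⟩ ha0 haη ho'0 hsm₁ (by unfold C1K at hsm₂; exact hsm₂)
  -- identification of both sides
  have hY₁ : Yc J ρ A c t₁ ω = oneSidedM ρ B o := by rw [Yc_eq_of_mem hM₁, (jets_of_mem halive₁ 0).2.2.2.2]
  have hY₂ : Yc J ρ A c t₂ ω = oneSidedM ρ (slidHull U B u) (o + a - U u) := by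
    rw [Yc_eq_of_mem hM₂, (jets_of_mem halive₂ 0).2.2.2.2, ho', hcoc]
  obtain ⟨e1, e2, e3, e4, -⟩ := jets_of_mem (J := J) (ρ := ρ) (A := A) (c := c) halive₁ (rho0K A k)
  have hucast : ((u : ℝ≥0) : ℂ) = (((t₂ : ℝ) - t₁ : ℝ) : ℂ) := by
    rw [← hucoe]
  have hW2 : |U u| = |drvC J ρ c t₂ ω - drvC J ρ c t₁ ω| := by rw [hUu]
  rw [hY₁, hY₂, e1, e2, e3, e4, ← hUu, ← hucast]
  refine hexp.trans (le_of_eq ?_)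
  rw [KstepK, deltaK, etaK, ← hℓdef, cellPoly, absorbW, haabs, hW2, ← hucoe, stepSize]

end Step

end SLEKappaRho

end Literature.Probability.RandomPlanarGeometry

end

/-!
## [LSW] Lemma 8.9 for SLE(8/3, ρ): jet bounds up to `τ_k`, and right-continuity of `M_t` at controlled times

G. F. Lawler, O. Schramm, W. Werner, *Conformal restriction: the chordal case*, J. Amer. Math.
Soc. **16** (2003) 917–955 (**[LSW]**), §8.4. Two inputs of the cell scheme (`SLEKappaRhoCellMartingale`)
for the processes of `SLEKappaRhoSchemeProcesses` localised by `tauK` (`SLEKappaRhoSchemeStopping`):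

* `bound_of_le_tauK` — **up to `τ_k` the jets `ℓ₁, m₁, ℓ₂, λ`, the clock and `|Z|` are bounded by
  the constant `KbigK`** (`norm_jets_le`, `norm_lam_zero_le` under the jet control of
  `jetControl_of_le_tauK`);
* `rightCts_Yc` — **for every sample, `t ↦ Y_t` is right-continuous at every `t ≤ τ_k`**. If
  `Z_t > 0` the one-step expansion `oneStep_pathwise` applies on a right neighbourhood (there
  `o = −Z`), and the step bound tends to `0` (`CellScheme.tendsto_stepBound`); if `Z_t ≤ 0` then
  `o_t = 0`, `Y_t = Φ'_{B_t}(0)^α`, and for `s ↓ t` the deterministic estimate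
  `|M(B, o) − Φ'_B(0)^α| ≤ exp(L|o|) − 1` (`abs_oneSidedM_sub_rpow_le`, from (8.2)
  `factors_mem_Icc`/`hullDeriv_le_hullSlope_le` and the Lipschitz bound `norm_deriv_starMap_sub_le`)
  together with the continuity of `s ↦ Φ'_{B_s}(0)` (`continuousWithinAt_starDeriv_slidHull`)
  conclude.

No named facts.
-/

noncomputable section

open Set Filter Metric Function MeasureTheory
open _root_.Complex _root_.Topology
open scoped NNReal ENNReal
open Literature.Probability.Process

namespace Literature.Probability.RandomPlanarGeometry

namespace SLEKappaRho

open Loewner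

variable {J : ℝ≥0 → (ℝ≥0 → ℝ) → ℝ} {ρ : ℝ} {A : Set ℂ}

/-! ### `|M(B, o) − Φ'_B(0)^α| ≤ exp(L |o|) − 1` near the diagonal -/

/-- Logarithms of a squeezed ratio: `d ≤ x ≤ d + q` with `0 < d` gives `0 ≤ log x − log d ≤ q/d`.
[folklore] -/
theorem log_sub_log_mem {d x q : ℝ} (hd : 0 < d) (h1 : d ≤ x) (h2 : x ≤ d + q) :
    0 ≤ Real.log x - Real.log d ∧ Real.log x - Real.log d ≤ q / d := by
  have hx : 0 < x := hd.trans_le h1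
  refine ⟨sub_nonneg.2 (Real.log_le_log hd h1), ?_⟩
  rw [← Real.log_div hx.ne' hd.ne']
  have := Real.log_le_sub_one_of_pos (div_pos hx hd)
  have h3 : x / d - 1 ≤ q / d := by
    rw [div_sub_one hd.ne', div_le_div_iff_of_pos_right hd]; linarith
  linarith

/-- **Near the diagonal `M(B, o)` is close to `Φ'_B(0)^α`**: for an arc hull `B ∈ 𝒬₊` clear of
`B(0, 8r)` and `o ∈ (−r/10, 0]`,
`|M(B, o) − Φ'_B(0)^α| ≤ exp((|b| + |c|) (40/(r Φ'_B(0))) |o|) − 1` — by (8.2)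
(`Φ'_B(0) ≤ hullSlope ≤ Φ'_{B−o}(0)`) and the Lipschitz bound `|E_B'(o) − E_B'(0)| ≤ (40/r)|o|`.
[cite: LawlerSchrammWerner2003Restriction, Lemma 8.10 proof, (8.2)] -/
theorem abs_oneSidedM_sub_rpow_le {B : Set ℂ} (hB : IsPlusHull B) (hBa : IsArcHull B) {r : ℝ} (hr : 0 < r)
    (hclear : Disjoint (ball (0 : ℂ) (8 * r)) B) {ρ : ℝ} (hρ : -2 < ρ) {o : ℝ} (ho : o ≤ 0) (hor : |o| < r / 10) :
    |oneSidedM ρ B o - hullDeriv B ^ sleKappaRhoExponent ρ| ≤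
      Real.exp ((|expB ρ| + |expC ρ|) * (40 / (r * hullDeriv B)) * |o|) - 1 := by
  obtain ⟨V, S, hV, -, hV0, hhull⟩ := exists_chain_of_isArcHull hBa hB
  set d := hullDeriv B with hd
  set dₒ := hullDeriv (translate B o) with hdo
  set s := hullSlope B o with hs
  have hd0 : 0 < d := hullDeriv_pos B
  have hd1 : d ≤ 1 := hullDeriv_le_one B
  obtain ⟨⟨hddo, -⟩, ⟨hds, -⟩⟩ := factors_mem_Icc hV hB hhull hV0 ho
  -- `s ≤ dₒ`
  have hsdo : s ≤ dₒ := by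
    rcases ho.lt_or_eq with hlt | heq
    · exact (hullDeriv_le_hullSlope_le hV hB hhull hV0 hlt).2
    · rw [hs, hdo, heq, hullSlope_zero, translate_zero]
  -- `dₒ ≤ d + (40/r)|o|`
  have hclear0 : Disjoint (ball (((0 : ℝ) : ℂ)) (8 * r)) B := by simpa using hclear
  have hlip := norm_deriv_starMap_sub_le hB.1 hr hclear0 (z := (o : ℂ))
    (by rw [mem_ball, ofReal_zero, dist_zero_right, norm_real, Real.norm_eq_abs]; exact hor)
  have hdoeq : dₒ = (deriv (starMap B) o).re := by
    rw [hdo, hullDeriv_translate hB.1 (hB.ofReal_notMem_of_nonpos ho)]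
  have hdeq : d = (deriv (starMap B) ((0 : ℝ) : ℂ)).re := by
    rw [ofReal_zero, deriv_starMap_zero hB.1, ofReal_re, hd, hullDeriv_eq_starDeriv]
  have hup : dₒ ≤ d + 40 / r * |o| := by
    have h1 : dₒ - d ≤ ‖deriv (starMap B) o - deriv (starMap B) ((0 : ℝ) : ℂ)‖ := by
      rw [hdoeq, hdeq, ← sub_re]; exact re_le_norm _
    rw [ofReal_zero, sub_zero, norm_real, Real.norm_eq_abs] at hlip
    rw [ofReal_zero] at h1
    linarith
  -- logarithms
  set q := 40 / r * |o| with hq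
  obtain ⟨hlo1, hlo2⟩ := log_sub_log_mem hd0 hddo hup
  obtain ⟨hls1, hls2⟩ := log_sub_log_mem hd0 hds (hsdo.trans hup)
  have hdo0 : 0 < dₒ := hd0.trans_le hddo
  have hs0 : 0 < s := hd0.trans_le hds
  -- `M = exp(log M)`, `d^α = exp(α log d)`
  have hM : oneSidedM ρ B o = Real.exp (5 / 8 * Real.log d + expB ρ * Real.log dₒ + expC ρ * Real.log s) := by
    rw [oneSidedM, Real.exp_add, Real.exp_add, Real.rpow_def_of_pos hd0, Real.rpow_def_of_pos hdo0, Real.rpow_def_of_pos hs0]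
    ring_nf
  have hdα : d ^ sleKappaRhoExponent ρ = Real.exp (5 / 8 * Real.log d + expB ρ * Real.log d + expC ρ * Real.log d) := by
    rw [Real.rpow_def_of_pos hd0, ← five_eighths_add_expB_add_expC]; ring_nf
  set Δ := expB ρ * (Real.log dₒ - Real.log d) + expC ρ * (Real.log s - Real.log d) with hΔ
  have hΔb : |Δ| ≤ (|expB ρ| + |expC ρ|) * (40 / (r * d)) * |o| := by
    have e1 : |expB ρ * (Real.log dₒ - Real.log d)| ≤ |expB ρ| * (q / d) := by
      rw [abs_mul, abs_of_nonneg hlo1]; gcongr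
    have e2 : |expC ρ * (Real.log s - Real.log d)| ≤ |expC ρ| * (q / d) := by
      rw [abs_mul, abs_of_nonneg hls1]; gcongr
    have hqd : q / d = 40 / (r * d) * |o| := by rw [hq]; field_simp
    calc |Δ| ≤ |expB ρ * (Real.log dₒ - Real.log d)| + |expC ρ * (Real.log s - Real.log d)| := abs_add_le _ _
      _ ≤ |expB ρ| * (q / d) + |expC ρ| * (q / d) := add_le_add e1 e2
      _ = _ := by rw [hqd]; ring
  have hdα1 : d ^ sleKappaRhoExponent ρ ≤ 1 := Real.rpow_le_one hd0.le hd1 (sleKappaRhoExponent_pos hρ).le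
  have hdα0 : 0 ≤ d ^ sleKappaRhoExponent ρ := Real.rpow_nonneg hd0.le _
  have key : oneSidedM ρ B o - d ^ sleKappaRhoExponent ρ = d ^ sleKappaRhoExponent ρ * (Real.exp Δ - 1) := by
    have hP : 5 / 8 * Real.log d + expB ρ * Real.log dₒ + expC ρ * Real.log s =
        (5 / 8 * Real.log d + expB ρ * Real.log d + expC ρ * Real.log d) + Δ := by rw [hΔ]; ring
    rw [hM, hdα, hP, Real.exp_add]; ring
  rw [key, abs_mul, abs_of_nonneg hdα0]
  -- `|exp Δ − 1| ≤ exp |Δ| − 1`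
  have hexp1 : |Real.exp Δ - 1| ≤ Real.exp |Δ| - 1 := by
    rcases le_or_gt 0 Δ with hx | hx
    · rw [abs_of_nonneg hx, abs_of_nonneg (by linarith [Real.add_one_le_exp Δ])]
    · rw [abs_of_neg hx, abs_of_nonpos (by linarith [Real.exp_le_one_iff.2 hx.le])]
      have h1 := Real.add_one_le_exp Δ
      have h2 := Real.add_one_le_exp (-Δ)
      linarith
  calc d ^ sleKappaRhoExponent ρ * |Real.exp Δ - 1| ≤ 1 * (Real.exp |Δ| - 1) :=
        mul_le_mul hdα1 hexp1 (abs_nonneg _) zero_le_one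
    _ ≤ Real.exp ((|expB ρ| + |expC ρ|) * (40 / (r * d)) * |o|) - 1 := by
        rw [one_mul]; gcongr

/-! ### The big constant and the bounds up to `τ_k` -/

/-- **The bound `K` of the scheme at level `k`** (jets, `λ`, one-step constant, clock and `|Z|`). [folklore] -/
def KbigK (A : Set ℂ) (ρ : ℝ) (k : ℕ) : ℝ :=
  max (max (max (2 * ellBound ρ (deltaK A k) / etaK A k) (8 * ellBound ρ (deltaK A k) / etaK A k ^ 2))
    (max (lamBound ρ (deltaK A k) (etaK A k) (MgK A k)) (KstepK A ρ k))) (3 * k + 1)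

/-- The components of `KbigK`. [folklore] -/
theorem le_KbigK (A : Set ℂ) (ρ : ℝ) (k : ℕ) :
    2 * ellBound ρ (deltaK A k) / etaK A k ≤ KbigK A ρ k ∧ 8 * ellBound ρ (deltaK A k) / etaK A k ^ 2 ≤ KbigK A ρ k ∧
      lamBound ρ (deltaK A k) (etaK A k) (MgK A k) ≤ KbigK A ρ k ∧ KstepK A ρ k ≤ KbigK A ρ k ∧
      3 * (k : ℝ) + 1 ≤ KbigK A ρ k ∧ 1 ≤ KbigK A ρ k := by
  refine ⟨?_, ?_, ?_, ?_, le_max_right _ _, ?_⟩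
  · exact ((le_max_left _ _).trans (le_max_left _ _)).trans (le_max_left _ _)
  · exact ((le_max_right _ _).trans (le_max_left _ _)).trans (le_max_left _ _)
  · exact ((le_max_left _ _).trans (le_max_right _ _)).trans (le_max_left _ _)
  · exact ((le_max_right _ _).trans (le_max_right _ _)).trans (le_max_left _ _)
  · exact le_trans (by have := (Nat.cast_nonneg k : (0 : ℝ) ≤ k); linarith) (le_max_right _ _)

/-- **Up to `τ_k` the jets, the clock and `|Z|` are bounded by `KbigK`.**
[cite: LawlerSchrammWerner2003Restriction, §8.4 proof of Lemma 8.9] -/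
theorem bound_of_le_tauK (hAs : IsSmoothHull A) (hA : IsPlusHull A) (hne : A.Nonempty) {k : ℕ} {t : ℝ≥0}
    {ω : ℝ≥0 → ℝ} (ht : (t : WithTop ℝ≥0) ≤ tauK J ρ hA hne k ω) :
    ‖jL1 J ρ A (lvlN k) t ω‖ ≤ KbigK A ρ k ∧ ‖jM1 J ρ A (lvlN k) t ω‖ ≤ KbigK A ρ k ∧
      ‖jL2 J ρ A (lvlN k) t ω‖ ≤ KbigK A ρ k ∧ ‖jLam J ρ A (lvlN k) (rho0K A k) t ω‖ ≤ KbigK A ρ k ∧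
      clockTrunc J (lvlN k) t ω ≤ KbigK A ρ k ∧ |drvC J ρ (lvlN k) t ω + 2 * clockTrunc J (lvlN k) t ω| ≤ KbigK A ρ k := by
  obtain ⟨halive, -, -, hball, -, habso⟩ := geometry_of_le_tauK ht
  obtain ⟨-, -, -, hW, hI, -⟩ := controls_of_le_tauK ht
  have hJet := jetControl_of_le_tauK (J := J) (ρ := ρ) hAs ht
  obtain ⟨hℓ, hρ₀, hδ, hη, hη1, hMg⟩ := consts_pos hA hne k
  obtain ⟨hK1, hK2, hK3, -, hK5, hK6⟩ := le_KbigK A ρ k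
  have hBp : IsPlusHull (hullC J ρ A (lvlN k) t ω) := isPlusHull_hullC hA halive
  have hρ₀eq : 8 * rho0K A k = lvl A k := by rw [rho0K]; ring
  have hBρ : Disjoint (ball (0 : ℂ) (8 * rho0K A k)) (hullC J ρ A (lvlN k) t ω) := by rw [hρ₀eq]; exact hball
  obtain ⟨e1, e2, e3, e4, -⟩ := jets_of_mem (J := J) (ρ := ρ) (A := A) (c := lvlN k) halive (rho0K A k)
  have ho0 : oposC J ρ (lvlN k) t ω ≤ 0 := oposC_nonpos t ω
  have hoI : oposC J ρ (lvlN k) t ω ∈ Icc (-(3 * (k : ℝ)) - 2) (etaK A k) := by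
    have := habso; rw [abs_le] at this
    exact ⟨by linarith [this.1], ho0.trans hη.le⟩
  have hoI' : oposC J ρ (lvlN k) t ω ∈ Icc (-(3 * (k : ℝ)) - 2) (etaK A k / 2) := ⟨hoI.1, ho0.trans (by positivity)⟩
  obtain ⟨b1, b2, b3⟩ := norm_jets_le hJet ρ hoI
  have b4 := norm_lam_zero_le hBp.1 hρ₀ hBρ hJet ρ hoI'
  have hk0 : (0 : ℝ) ≤ k := Nat.cast_nonneg k
  have hZb : |drvC J ρ (lvlN k) t ω + 2 * clockTrunc J (lvlN k) t ω| ≤ KbigK A ρ k := by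
    have hI0 := (clockTrunc_mem_Icc (J := J) (lvlN k) t ω).1
    have h2 := abs_add_le (drvC J ρ (lvlN k) t ω) (2 * clockTrunc J (lvlN k) t ω)
    rw [abs_of_nonneg (by positivity : (0 : ℝ) ≤ 2 * clockTrunc J (lvlN k) t ω)] at h2
    linarith
  refine ⟨?_, ?_, ?_, ?_, ?_, hZb⟩
  · rw [e1]; exact b1.trans (by rw [deltaK, etaK] at hK1; exact hK1)
  · rw [e3]; exact b2.trans (by rw [deltaK, etaK] at hK1; exact hK1)
  · rw [e2]; exact b3.trans (by rw [deltaK, etaK] at hK2; exact hK2)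
  · rw [e4]; exact b4.trans (by rw [deltaK, etaK, MgK, rho0K, deltaK] at hK3; rw [rho0K]; exact hK3)
  · exact hI.trans (by linarith)

/-! ### Right-continuity of `Y` at controlled times -/

/-- From the one-step inequality to the size of the step (the algebra of
`CellScheme.abs_sub_le_stepBound`, for one pair of times). [folklore] -/
theorem abs_sub_le_stepBound_of_oneStep {K Y₁ Y₂ x dI' h' S dI h : ℝ} {ℓ₁ m₁ ℓ₂ Λ : ℂ} (hK : 0 ≤ K)
    (h1 : ‖ℓ₁‖ ≤ K) (hm1 : ‖m₁‖ ≤ K) (h2 : ‖ℓ₂‖ ≤ K) (hl : ‖Λ‖ ≤ K) (hY : |Y₁| ≤ 1)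
    (hx : |x| ≤ S) (hI0 : 0 ≤ dI') (hI : dI' ≤ dI) (hh0 : 0 ≤ h') (hh : h' ≤ h)
    (hstep : ‖((Y₂ : ℝ) : ℂ) - Y₁ - Y₁ * (ℓ₁ * (x : ℂ) + m₁ * ((-2 * dI' : ℝ) : ℂ) + 2⁻¹ * (ℓ₂ + ℓ₁ ^ 2) * (x : ℂ) ^ 2 + (h' : ℂ) * Λ)‖ ≤
      K * cellPoly |x| (2 * dI') h' (S + 4 * Real.sqrt h')) :
    |Y₂ - Y₁| ≤ stepBound K S dI h := by
  have hS0 : 0 ≤ S := (abs_nonneg _).trans hx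
  have hhn : 0 ≤ h := hh0.trans hh
  set model := ℓ₁ * (x : ℂ) + m₁ * ((-2 * dI' : ℝ) : ℂ) + 2⁻¹ * (ℓ₂ + ℓ₁ ^ 2) * (x : ℂ) ^ 2 + (h' : ℂ) * Λ with hmodel
  have hsq : ‖ℓ₂ + ℓ₁ ^ 2‖ ≤ K + K ^ 2 := (norm_add_le _ _).trans (add_le_add h2 (by rw [norm_pow]; gcongr))
  have hmodelb : ‖model‖ ≤ K * S + 2 * K * dI + 2⁻¹ * (K + K ^ 2) * S ^ 2 + h * K := by
    rw [hmodel]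
    refine (norm_add_le _ _).trans (add_le_add ((norm_add₃_le).trans (add_le_add (add_le_add ?_ ?_) ?_)) ?_)
    · rw [norm_mul, Complex.norm_real, Real.norm_eq_abs]; gcongr
    · rw [norm_mul, Complex.norm_real, Real.norm_eq_abs, abs_mul, abs_neg, abs_two, abs_of_nonneg hI0]
      calc ‖m₁‖ * (2 * dI') ≤ K * (2 * dI) := by gcongr
        _ = 2 * K * dI := by ring
    · rw [norm_mul, norm_mul, norm_inv, Complex.norm_ofNat, norm_pow, Complex.norm_real, Real.norm_eq_abs]
      gcongr
    · rw [norm_mul, Complex.norm_real, Real.norm_eq_abs, abs_of_nonneg hh0]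
      calc h' * ‖Λ‖ ≤ h * K := by gcongr
        _ = h * K := rfl
  have hpoly : cellPoly |x| (2 * dI') h' (S + 4 * Real.sqrt h') ≤ cellPoly S (2 * dI) h (S + 4 * Real.sqrt h) :=
    cellPoly_mono (abs_nonneg _) (by positivity) hh0 (by positivity) hx (by linarith) hh (by gcongr)
  have e : (((Y₂ - Y₁ : ℝ)) : ℂ) = (((Y₂ : ℝ) : ℂ) - Y₁ - Y₁ * model) + Y₁ * model := by push_cast; ring
  have hn : |Y₂ - Y₁| = ‖(((Y₂ - Y₁ : ℝ)) : ℂ)‖ := by rw [Complex.norm_real, Real.norm_eq_abs]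
  rw [hn, e, stepBound]
  calc _ ≤ ‖((Y₂ : ℝ) : ℂ) - Y₁ - Y₁ * model‖ + ‖((Y₁ : ℝ) : ℂ) * model‖ := norm_add_le _ _
    _ ≤ K * cellPoly S (2 * dI) h (S + 4 * Real.sqrt h) + 1 * (K * S + 2 * K * dI + 2⁻¹ * (K + K ^ 2) * S ^ 2 + h * K) := by
        gcongr
        · exact hstep.trans (mul_le_mul_of_nonneg_left hpoly hK)
        · rw [norm_mul, Complex.norm_real, Real.norm_eq_abs]
          exact mul_le_mul hY hmodelb (norm_nonneg _) zero_le_one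
    _ = _ := by ring

/-- **Right-continuity of `Y` at every controlled time `t₁ ≤ τ_k`, for every sample.**
[cite: LawlerSchrammWerner2003Restriction, §8.4 (M_t, t < T)] -/
theorem rightCts_Yc (hAs : IsSmoothHull A) (hA : IsPlusHull A) (hne : A.Nonempty) (hρ : -2 < ρ) {k : ℕ} {t₁ : ℝ≥0}
    {ω : ℝ≥0 → ℝ} (hτ : (t₁ : WithTop ℝ≥0) ≤ tauK J ρ hA hne k ω) :
    ContinuousWithinAt (fun r ↦ Yc J ρ A (lvlN k) r ω) (Ici t₁) t₁ := by
  set c := lvlN k with hc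
  set Z : ℝ≥0 → ℝ := fun r ↦ drvC J ρ c r ω + 2 * clockTrunc J c r ω with hZ
  have hZc : Continuous Z := (continuous_drvPath ω).add (continuous_const.mul (continuous_clockTrunc c ω))
  have hWc : Continuous fun r ↦ drvC J ρ c r ω := continuous_drvPath ω
  have hIc : Continuous fun r ↦ clockTrunc J c r ω := continuous_clockTrunc c ω
  obtain ⟨hc0, hcm, hc64, -⟩ := c0K_pos_le hA hne ρ k
  obtain ⟨hK1, hK2, hK3, hK4, hK5, hK6⟩ := le_KbigK A ρ k
  have hK0 : 0 ≤ KbigK A ρ k := zero_le_one.trans hK6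
  rw [Metric.continuousWithinAt_iff]
  intro ε hε
  rcases lt_or_ge 0 (Z t₁) with hZpos | hZle
  · /- Case `Z_{t₁} > 0`: the one-step expansion on a right neighbourhood. -/
    -- the modulus from the step bound
    have hev : ∀ᶠ p : ℝ × ℝ × ℝ in 𝓝[{p | 0 ≤ p.2.2}] (0, 0, 0), stepBound (KbigK A ρ k) p.1 p.2.1 p.2.2 < ε :=
      CellScheme.tendsto_stepBound (KbigK A ρ k) (Iio_mem_nhds hε)
    rw [eventually_nhdsWithin_iff, Metric.eventually_nhds_iff] at hev
    obtain ⟨δ, hδ, hδε⟩ := hev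
    set η := min (δ / 2) (c0K A ρ k) with hη
    have hη0 : 0 < η := lt_min (by positivity) hc0
    have hηc : η ≤ c0K A ρ k := min_le_right _ _
    have hηδ : η ≤ δ / 2 := min_le_left _ _
    -- neighbourhoods from continuity of `W`, `I`, `Z` at `t₁`
    obtain ⟨δ₁, hδ₁, hWδ⟩ := Metric.continuousAt_iff.1 (hWc.continuousAt (x := t₁)) (η / 2) (by positivity)
    obtain ⟨δ₂, hδ₂, hIδ⟩ := Metric.continuousAt_iff.1 (hIc.continuousAt (x := t₁)) η hη0
    obtain ⟨δ₃, hδ₃, hZδ⟩ := Metric.continuousAt_iff.1 (hZc.continuousAt (x := t₁)) (Z t₁) hZpos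
    refine ⟨min η (min δ₁ (min δ₂ δ₃)), lt_min hη0 (lt_min hδ₁ (lt_min hδ₂ hδ₃)), fun r hr hdist ↦ ?_⟩
    rcases (show t₁ ≤ r from hr).eq_or_lt with heq | hlt
    · subst heq; simpa using hε
    have hlt' : (t₁ : ℝ) ≤ r := by exact_mod_cast hlt.le
    have hdist' : (r : ℝ) - t₁ < min η (min δ₁ (min δ₂ δ₃)) := by
      rw [NNReal.dist_eq, abs_of_nonneg (by linarith)] at hdist; exact hdist
    have hh : (r : ℝ) - t₁ ≤ η := (hdist'.trans_le (min_le_left _ _)).le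
    have hosc : ∀ r', t₁ ≤ r' → r' ≤ r → |drvC J ρ c r' ω - drvC J ρ c t₁ ω| ≤ η := by
      intro r' h1' h2'
      have e1 : (t₁ : ℝ) ≤ r' := by exact_mod_cast h1'
      have e2 : (r' : ℝ) ≤ r := by exact_mod_cast h2'
      have hd : dist r' t₁ < δ₁ := by
        rw [NNReal.dist_eq, abs_of_nonneg (by linarith)]
        linarith [hdist'.trans_le ((min_le_right _ _).trans (min_le_left _ _))]
      have := hWδ hd
      rw [Real.dist_eq] at this
      exact this.le.trans (by linarith)
    have hI : clockTrunc J c r ω - clockTrunc J c t₁ ω ≤ η := by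
      have hd : dist r t₁ < δ₂ := hdist.trans_le ((min_le_right _ _).trans ((min_le_right _ _).trans (min_le_left _ _)))
      have := hIδ hd
      rw [Real.dist_eq] at this
      exact (le_abs_self _).trans this.le
    have hZr : 0 ≤ Z r := by
      have hd : dist r t₁ < δ₃ := hdist.trans_le ((min_le_right _ _).trans ((min_le_right _ _).trans (min_le_right _ _)))
      have := hZδ hd
      rw [Real.dist_eq] at this
      have := neg_abs_le (Z r - Z t₁)
      linarith
    -- the one-step inequality and the bounds
    have hstep := oneStep_pathwise (J := J) hAs hA hne hτ hlt (hh.trans hηc) hosc hηc hρ (hI.trans hηc) hZpos.le hZr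
    obtain ⟨b1, bm, b2, bl, -, -⟩ := bound_of_le_tauK (J := J) (ρ := ρ) hAs hA hne hτ
    have hY1 : |Yc J ρ A c t₁ ω| ≤ 1 := by
      have hm := Yc_mem_Icc (J := J) (ρ := ρ) (A := A) (c := c) t₁ ω
      exact abs_le.2 ⟨by linarith [hm.1], hm.2⟩
    have hx : |drvC J ρ c r ω - drvC J ρ c t₁ ω| ≤ η := hosc r hlt.le le_rfl
    have hI0 : 0 ≤ clockTrunc J c r ω - clockTrunc J c t₁ ω := sub_nonneg.2 (monotone_clockTrunc c ω hlt.le)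
    have h0 : (0 : ℝ) ≤ (r : ℝ) - t₁ := by linarith
    have hb := abs_sub_le_stepBound_of_oneStep hK0 b1 bm b2 bl hY1 hx hI0 hI h0 hh
      (hstep.trans (mul_le_mul_of_nonneg_right hK4 (cellPoly_nonneg (abs_nonneg _) (by positivity) h0 (by positivity))))
    rw [Real.dist_eq]
    refine hb.trans_lt (hδε ?_ (show (0 : ℝ) ≤ (η, η, η).2.2 from hη0.le))
    rw [dist_eq_norm, Prod.norm_def, Prod.norm_def]
    simp only [Prod.fst_sub, Prod.snd_sub, sub_zero, Real.norm_eq_abs, abs_of_pos hη0, max_self]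
    linarith
  · /- Case `Z_{t₁} ≤ 0`: `o = 0` near `t₁`, `Y = Φ'^α` at `t₁`, squeeze at the later times. -/
    obtain ⟨halive₁, hd, -, hball, -, -⟩ := geometry_of_le_tauK hτ
    have hℓ := (lvl_pos_le hA hne k).1
    have hℓ1 := (lvl_pos_le hA hne k).2.2.2
    set W : ℝ≥0 → ℝ := drvPath J ρ c ω with hWdef
    have hWcont : Continuous W := continuous_drvPath ω
    have hW0 : W 0 = 0 := drvPath_zero ω
    have ho1 : oposC J ρ c t₁ ω = 0 := by
      rw [oposC]; exact min_eq_right (by simp only [hZ] at hZle; linarith)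
    -- value at `t₁`
    have hBp₁ : IsPlusHull (hullC J ρ A c t₁ ω) := isPlusHull_hullC hA halive₁
    have hY₁ : Yc J ρ A c t₁ ω = max 0 (min 1 (hullDeriv (hullC J ρ A c t₁ ω) ^ sleKappaRhoExponent ρ)) := by
      rw [Yc, Mraw, Set.indicator_of_mem halive₁, ho1, oneSidedM_zero]
    -- right neighbourhood of alive times, and continuity of `Φ'` there
    obtain ⟨t₃, ht₃, halive₃⟩ := exists_lt_disjoint (W := fun ω' : ℝ≥0 → ℝ ↦ drvPath J ρ c ω') (ω := ω) hWcont hA.1 halive₁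
    have hdc := continuousWithinAt_starDeriv_slidHull (W := W) hWcont hA.1 hne halive₁
    -- the target function `v ↦ Φ'_{B_v}(0)^α` is continuous at `t₁` within the alive times
    have hα0 : 0 < sleKappaRhoExponent ρ := sleKappaRhoExponent_pos hρ
    have hpow : ContinuousWithinAt (fun v : ℝ≥0 ↦ starDeriv (slidHull W A v) ^ sleKappaRhoExponent ρ)
        {v | Disjoint (closedHull W v) A} t₁ :=
      hdc.rpow_const (Or.inr hα0.le)
    rw [Metric.continuousWithinAt_iff] at hpow
    obtain ⟨δ₁, hδ₁, hpowδ⟩ := hpow (ε / 2) (by positivity)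
    -- the control of `o` near `t₁`: `|o_r| < min (ℓ/10) (small)` with `exp(L small) − 1 < ε/2`
    set L := (|expB ρ| + |expC ρ|) * (40 / (lvl A k / 16 * (lvl A k / 2))) with hL
    have hL0 : 0 ≤ L := by positivity
    have hexp : ContinuousAt (fun x : ℝ ↦ Real.exp (L * x) - 1) 0 := by fun_prop
    rw [Metric.continuousAt_iff] at hexp
    obtain ⟨δ₄, hδ₄, hexpδ⟩ := hexp (ε / 2) (by positivity)
    have hoc : Continuous fun r ↦ oposC J ρ c r ω := continuous_oposC ω
    obtain ⟨δ₂, hδ₂, hoδ⟩ := Metric.continuousAt_iff.1 (hoc.continuousAt (x := t₁)) (min (lvl A k / 16 / 10) δ₄)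
      (lt_min (by positivity) hδ₄)
    -- alive margin persists: `ctlR ≥ ℓ/2` near `t₁` (continuity of the control)
    obtain ⟨hcR, hcD, -⟩ := continuous_ctl (J := J) (ρ := ρ) (hA := hA.1) (hne := hne) (c := c) ω
    obtain ⟨hR₁, hD₁, -⟩ := controls_of_le_tauK hτ
    obtain ⟨δ₅, hδ₅, hRδ⟩ := Metric.continuousAt_iff.1 (hcR.continuousAt (x := t₁)) (lvl A k / 2) (by positivity)
    obtain ⟨δ₆, hδ₆, hDδ⟩ := Metric.continuousAt_iff.1 (hcD.continuousAt (x := t₁)) (lvl A k / 2) (by positivity)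
    refine ⟨min (dist t₃ t₁) (min δ₁ (min δ₂ (min δ₅ δ₆))),
      lt_min (dist_pos.2 (ne_of_gt ht₃)) (lt_min hδ₁ (lt_min hδ₂ (lt_min hδ₅ hδ₆))), fun r hr hdist ↦ ?_⟩
    have hrt₁ : t₁ ≤ r := hr
    have hlt₃ : r < t₃ := by
      have h1 : dist r t₁ < dist t₃ t₁ := hdist.trans_le (min_le_left _ _)
      have e1 : (t₁ : ℝ) ≤ r := by exact_mod_cast hrt₁
      have e2 : (t₁ : ℝ) ≤ t₃ := by exact_mod_cast ht₃.le
      rw [NNReal.dist_eq, NNReal.dist_eq, abs_of_nonneg (by linarith), abs_of_nonneg (by linarith)] at h1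
      exact_mod_cast (show (r : ℝ) < t₃ by linarith)
    have haliver : Disjoint (closedHull W r) A := alive_mono hlt₃.le halive₃
    have hmemr : ω ∈ aliveEv J ρ A c r := haliver
    have hd₁ : dist r t₁ < δ₁ := hdist.trans_le ((min_le_right _ _).trans (min_le_left _ _))
    have hd₂ : dist r t₁ < δ₂ := hdist.trans_le ((min_le_right _ _).trans ((min_le_right _ _).trans (min_le_left _ _)))
    have hd₅ : dist r t₁ < δ₅ := hdist.trans_le ((min_le_right _ _).trans ((min_le_right _ _).trans ((min_le_right _ _).trans (min_le_left _ _))))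
    have hd₆ : dist r t₁ < δ₆ := hdist.trans_le ((min_le_right _ _).trans ((min_le_right _ _).trans ((min_le_right _ _).trans (min_le_right _ _))))
    -- geometry at `r`: alive margin `≥ ℓ/2` and `Φ' ≥ ℓ/2`
    have hsp := denseSeq_spec hA.1 hne
    have hRr : lvl A k / 2 ≤ ctlR J ρ hA.1 hne c r ω := by
      have := hRδ hd₅; rw [Real.dist_eq] at this
      have := neg_abs_le (ctlR J ρ hA.1 hne c r ω - ctlR J ρ hA.1 hne c t₁ ω)
      linarith
    have hDr : lvl A k / 2 ≤ ctlD J ρ hA.1 hne c r ω := by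
      have := hDδ hd₆; rw [Real.dist_eq] at this
      have := neg_abs_le (ctlD J ρ hA.1 hne c r ω - ctlD J ρ hA.1 hne c t₁ ω)
      linarith
    have hballr : Disjoint (ball (0 : ℂ) (lvl A k / 2)) (slidHull W A r) := by
      have := disjoint_ball_zero_of_le_mul_aliveFn (W := drvPath J ρ c) hWcont hW0 hA.1 hne hsp.1 hsp.2 one_pos
        (by positivity : 0 < lvl A k / 2) (by rw [one_mul]; exact hRr)
      rwa [div_one] at this
    obtain ⟨-, hdr⟩ := starDeriv_ge_of_le_derivCtl (W := drvPath J ρ c) hWcont hW0 hA.1 hne hsp.1 hsp.2 zero_le_one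
      (by positivity : 0 < lvl A k / 2) hDr
    have hBp : IsPlusHull (slidHull W A r) := isPlusHull_slidHull_of_disjoint hWcont hW0 hA haliver
    have hBa : IsArcHull (slidHull W A r) := isArcHull_slidHull_of_disjoint hWcont hAs.isArcHull hA.1.zero_notMem haliver
    -- `o_r` is small
    have hor : |oposC J ρ c r ω| < min (lvl A k / 16 / 10) δ₄ := by
      have := hoδ hd₂; rw [Real.dist_eq, ho1, sub_zero] at this; exact this
    -- the squeeze at `r`
    have hclear8 : Disjoint (ball (0 : ℂ) (8 * (lvl A k / 16))) (slidHull W A r) := by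
      rw [show 8 * (lvl A k / 16) = lvl A k / 2 by ring]; exact hballr
    have hsq := abs_oneSidedM_sub_rpow_le hBp hBa (by positivity : 0 < lvl A k / 16) hclear8 hρ (oposC_nonpos r ω)
      (hor.trans_le (min_le_left _ _))
    -- the exponent at `r` is `≤ L |o_r|` since `Φ'_{B_r}(0) ≥ ℓ/2`
    have hXL : (|expB ρ| + |expC ρ|) * (40 / (lvl A k / 16 * hullDeriv (slidHull W A r))) ≤ L := by
      rw [hL, hullDeriv_eq_starDeriv]
      refine mul_le_mul_of_nonneg_left ?_ (by positivity)
      exact div_le_div_of_nonneg_left (by norm_num) (by positivity) (by nlinarith [hdr, hℓ])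
    have hexpb : Real.exp ((|expB ρ| + |expC ρ|) * (40 / (lvl A k / 16 * hullDeriv (slidHull W A r))) * |oposC J ρ c r ω|) - 1 ≤
        Real.exp (L * |oposC J ρ c r ω|) - 1 :=
      sub_le_sub_right (Real.exp_le_exp.2 (mul_le_mul_of_nonneg_right hXL (abs_nonneg _))) 1
    have hsmall : Real.exp (L * |oposC J ρ c r ω|) - 1 < ε / 2 := by
      have hd4 : dist |oposC J ρ c r ω| 0 < δ₄ := by
        rw [Real.dist_eq, sub_zero, abs_abs]; exact hor.trans_le (min_le_right _ _)
      have := hexpδ hd4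
      rw [Real.dist_eq, mul_zero, Real.exp_zero, sub_self, sub_zero] at this
      exact lt_of_abs_lt this
    -- continuity of `Φ'^α`
    have hpr := hpowδ haliver hd₁
    rw [Real.dist_eq] at hpr ⊢
    -- assemble
    have hYr : Yc J ρ A c r ω = max 0 (min 1 (oneSidedM ρ (slidHull W A r) (oposC J ρ c r ω))) := by
      rw [Yc, Mraw, Set.indicator_of_mem hmemr]
    rw [hYr, hY₁]
    -- the clamp `a ↦ (a ∨ 0) ∧ 1` is `1`-Lipschitz
    have hclamp : ∀ a b : ℝ, |max 0 (min 1 a) - max 0 (min 1 b)| ≤ |a - b| := fun a b ↦ by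
      have h1 : |min 1 a - min 1 b| ≤ |a - b| := abs_min_sub_min_le_max _ _ _ _ |>.trans (by simp)
      exact (abs_max_sub_max_le_max _ _ _ _).trans (by simpa using h1)
    refine (hclamp _ _).trans_lt ?_
    have e : oneSidedM ρ (slidHull W A r) (oposC J ρ c r ω) - hullDeriv (hullC J ρ A c t₁ ω) ^ sleKappaRhoExponent ρ =
        (oneSidedM ρ (slidHull W A r) (oposC J ρ c r ω) - hullDeriv (slidHull W A r) ^ sleKappaRhoExponent ρ) +
          (starDeriv (slidHull W A r) ^ sleKappaRhoExponent ρ - starDeriv (slidHull W A t₁) ^ sleKappaRhoExponent ρ) := by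
      rw [hullDeriv_eq_starDeriv, hullDeriv_eq_starDeriv, hullC]; ring
    rw [e]
    calc _ ≤ |oneSidedM ρ (slidHull W A r) (oposC J ρ c r ω) - hullDeriv (slidHull W A r) ^ sleKappaRhoExponent ρ| +
          |starDeriv (slidHull W A r) ^ sleKappaRhoExponent ρ - starDeriv (slidHull W A t₁) ^ sleKappaRhoExponent ρ| := abs_add_le _ _
      _ < ε / 2 + ε / 2 := add_lt_add (hsq.trans hexpb |>.trans_lt hsmall) hpr
      _ = ε := by ring

end SLEKappaRho

end Literature.Probability.RandomPlanarGeometry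

end

/-!
## [LSW] Lemma 8.9 for SLE(8/3, ρ): the cell scheme of level `k`

G. F. Lawler, O. Schramm, W. Werner, *Conformal restriction: the chordal case*, J. Amer. Math.
Soc. **16** (2003) 917–955 (**[LSW]**), §8.3–8.4, Lemma 8.9: "`M_t` is a local martingale". The
SLE(8/3, ρ) driving pair `(O, W)` of the tree has a regular version `(W', J)` almost all of whose
paths are good (`IsSLEKappaRhoPair.exists_regularPair_goodPath`): `W' = W = √(8/3) B + ρ∫J`,
`O = −2∫J`, `Z' = W' + 2∫J ≥ 0`. With the synthetic, everywhere-continuous driver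
`drvC J ρ (k+1) = √(8/3) B + ρ · clockTrunc J (k+1)` (`SLEKappaRhoSchemeDriver`) the processes of
`SLEKappaRhoSchemeProcesses` localised by `tauK` (`SLEKappaRhoSchemeStopping`) form a **cell
scheme** (`SLEKappaRho.CellScheme`, `SLEKappaRhoCellMartingale`):

* `cellScheme_level` — **the cell scheme of level `k`**: constants `κ = 8/3`, `K = KbigK`,
  `c₀ = c0K`, horizon `k + 1`; the almost-sure fields (clock, drift identity `drift_identity`,
  one-step expansion `oneStep_pathwise`) hold on the good paths, where up to `τ_k` the truncation of
  the clock is inactive, so that `Z = W + 2I = Z' ≥ 0` and `o = −Z`; the bounds and the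
  right-continuity are `bound_of_le_tauK`, `rightCts_Yc`;
* `martingale_stoppedProcess_level` — hence **`Y^{τ_k}` is a martingale** for the Brownian
  filtration (`CellScheme.martingale_stoppedProcess`), adapted, with a.s. continuous paths.

No named facts.
-/

noncomputable section

open Set Filter Metric Function MeasureTheory
open _root_.Complex _root_.Topology
open scoped NNReal ENNReal
open Literature.Probability.Process Literature.Analysis.FunctionSpaces

namespace Literature.Probability.RandomPlanarGeometry

namespace SLEKappaRho

open Loewner

variable {J : ℝ≥0 → (ℝ≥0 → ℝ) → ℝ} {ρ : ℝ} {A : Set ℂ} {O W W' : ℝ≥0 → (ℝ≥0 → ℝ) → ℝ}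

/-! ### Good paths and the truncated clock -/

/-- `((8/3 : ℝ≥0) : ℝ) = 8/3`. [folklore] -/
theorem coe_eight_thirds : ((8 / 3 : ℝ≥0) : ℝ) = 8 / 3 := by norm_num

/-- `Z' = W' + 2∫J ≥ 0` everywhere, since `J = 1/Z' ≥ 0`. [folklore] -/
theorem RegularPair.zPrime_nonneg {κ : ℝ≥0} (hreg : RegularPair κ ρ W W' J) (t : ℝ≥0) (ω : ℝ≥0 → ℝ) :
    0 ≤ W' t ω + 2 * timeIntegral J t ω := by
  have h := hreg.nonneg t ω
  rw [hreg.eq_inv t ω] at h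
  exact inv_nonneg.1 h

/-- On a good path `J` is integrable on every `(0, t]`. [folklore] -/
theorem GoodPath.integrableOn_Ioc {κ : ℝ≥0} {ω : ℝ≥0 → ℝ} (hgood : GoodPath κ ρ O W W' J ω) (t : ℝ≥0) :
    IntegrableOn (fun s : ℝ ↦ J s.toNNReal ω) (Ioc (0 : ℝ) t) :=
  (intervalIntegrable_iff_integrableOn_Ioc_of_le t.coe_nonneg).1 (hgood.intervalIntegrable t)

section Good

variable (hreg : RegularPair (8 / 3) ρ W W' J) {ω : ℝ≥0 → ℝ} (hgood : GoodPath (8 / 3) ρ O W W' J ω)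
include hreg hgood

/-- **On a good path, while the truncation is inactive the synthetic pair is the true one**:
`clockTrunc = ∫J`, `Z = W + 2I = Z' ≥ 0`, `o = −Z`, and `drvC = W`. [folklore] -/
theorem good_of_clockTrunc_lt {c t : ℝ≥0} (hlt : clockTrunc J c t ω < c) :
    clockTrunc J c t ω = timeIntegral J t ω ∧ drvC J ρ c t ω = W t ω ∧
      drvC J ρ c t ω + 2 * clockTrunc J c t ω = W' t ω + 2 * timeIntegral J t ω ∧
      0 ≤ drvC J ρ c t ω + 2 * clockTrunc J c t ω ∧
      oposC J ρ c t ω = -(drvC J ρ c t ω + 2 * clockTrunc J c t ω) := by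
  have h1 : clockTrunc J c t ω = timeIntegral J t ω :=
    clockTrunc_eq_timeIntegral_of_lt (fun s ↦ hreg.nonneg s ω) hgood.integrableOn_Ioc hlt
  have h2 : drvC J ρ c t ω = W' t ω := by
    rw [drvC, h1, hgood.eq_brownian t, coe_eight_thirds]
  have h3 : drvC J ρ c t ω + 2 * clockTrunc J c t ω = W' t ω + 2 * timeIntegral J t ω := by rw [h2, h1]
  have h4 : 0 ≤ drvC J ρ c t ω + 2 * clockTrunc J c t ω := by rw [h3]; exact hreg.zPrime_nonneg t ω
  exact ⟨h1, by rw [h2, hgood.eq t], h3, h4, by rw [oposC]; exact min_eq_left (by linarith)⟩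

end Good

/-- Up to `τ_k` the truncation at level `k + 1` is inactive. [folklore] -/
theorem clockTrunc_lt_of_le_tauK {hA : IsPlusHull A} {hne : A.Nonempty} {k : ℕ} {t : ℝ≥0} {ω : ℝ≥0 → ℝ}
    (ht : (t : WithTop ℝ≥0) ≤ tauK J ρ hA hne k ω) : clockTrunc J (lvlN k) t ω < lvlN k := by
  obtain ⟨-, -, -, -, hI, -⟩ := controls_of_le_tauK ht
  calc clockTrunc J (lvlN k) t ω ≤ k := hI
    _ < (lvlN k : ℝ) := by rw [coe_lvlN]; exact lt_add_one _

/-! ### The cell scheme of level `k` -/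

/-- **The cell scheme of level `k` for SLE(8/3, ρ)** ([LSW] Lemma 8.9, proof).
[cite: LawlerSchrammWerner2003Restriction, Lemma 8.9 and its proof (§8.4)] -/
theorem cellScheme_level (hAs : IsSmoothHull A) (hA : IsPlusHull A) (hne : A.Nonempty) (hρ : -2 < ρ)
    (hreg : RegularPair (8 / 3) ρ W W' J) (hgood : ∀ᵐ ω ∂preWienerMeasure, GoodPath (8 / 3) ρ O W W' J ω) (k : ℕ) :
    CellScheme (8 / 3) ρ (KbigK A ρ k) (c0K A ρ k) (lvlN k) (Yc J ρ A (lvlN k)) (clockTrunc J (lvlN k)) (drvC J ρ (lvlN k)) J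
      (jL1 J ρ A (lvlN k)) (jM1 J ρ A (lvlN k)) (jL2 J ρ A (lvlN k)) (jLam J ρ A (lvlN k) (rho0K A k))
      (tauK J ρ hA hne k) := by
  obtain ⟨hc0, hcm, hc64, -⟩ := c0K_pos_le hA hne ρ k
  obtain ⟨hK1, hK2, hK3, hK4, hK5, hK6⟩ := le_KbigK A ρ k
  have hJ := hreg.progressive
  refine
    { κ_pos := by norm_num
      K_pos := zero_lt_one.trans_le hK6
      c₀_pos := hc0
      c₀_le_one := hc64.trans (by norm_num)
      adapted_Y := adapted_Yc hJ hA hne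
      adapted_I := adapted_clockTrunc hJ (lvlN k)
      adapted_W := adapted_drvC hJ
      adapted_ℓ₁ := adapted_jL1 hJ hA hne
      adapted_ℓ₂ := adapted_jL2 hJ hA hne
      isStoppingTime := isStoppingTime_tauK hJ k
      τ_le := tauK_le k
      Y_mem := Yc_mem_Icc
      continuous_I := continuous_clockTrunc (lvlN k)
      monotone_I := monotone_clockTrunc (lvlN k)
      I_nonneg := fun t ω ↦ (clockTrunc_mem_Icc (lvlN k) t ω).1
      continuous_W := continuous_drvPath
      J_nonneg := hreg.nonneg
      ae_W := Eventually.of_forall fun ω t ↦ rfl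
      ae_clock := ?_
      bound := fun t ω ht ↦ bound_of_le_tauK hAs hA hne ht
      ae_identity := ?_
      ae_one_step := ?_
      rightCts := fun ω t₁ ht ↦ rightCts_Yc hAs hA hne hρ ht }
  · -- the clock on good paths
    filter_upwards [hgood] with ω hω
    refine ⟨hω.intervalIntegrable, fun t ht ↦ ?_, ?_⟩
    · obtain ⟨h1, -, h3, -, -⟩ := good_of_clockTrunc_lt hreg hω (clockTrunc_lt_of_le_tauK ht)
      refine ⟨h1, ?_⟩
      rw [h3]
      have hJt : J t ω = (W' t ω + 2 * timeIntegral J t ω)⁻¹ := hreg.eq_inv t ω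
      split_ifs with hz
      · rw [hz, zero_mul]
      · rw [hJt, mul_inv_cancel₀ hz]
    · -- the zero set of `Z` before `τ` is inside the (null) zero set of `Z'`
      have hnull : volume {r : ℝ | 0 < r ∧ W' r.toNNReal ω + 2 * timeIntegral J r.toNNReal ω = 0} = 0 := by
        have h := hω.ae_pos
        rw [ae_restrict_iff' measurableSet_Ioi] at h
        rw [← compl_mem_ae_iff]
        filter_upwards [h] with r hr
        simp only [mem_compl_iff, mem_setOf_eq, not_and]
        intro hr0 h0
        exact (hr hr0).ne' h0
      refine measure_mono_null (fun r hr ↦ ?_) hnull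
      obtain ⟨hr0, hrτ, hz⟩ := hr
      obtain ⟨-, -, h3, -, -⟩ := good_of_clockTrunc_lt hreg hω (clockTrunc_lt_of_le_tauK hrτ)
      exact ⟨hr0, by rw [← h3]; exact hz⟩
  · -- the drift identity on good paths
    filter_upwards [hgood] with ω hω
    intro t ht
    obtain ⟨halive, -, -, hball, -, habso⟩ := geometry_of_le_tauK ht.le
    have hJet := jetControl_of_le_tauK (J := J) (ρ := ρ) hAs ht.le
    obtain ⟨hℓ, hρ₀, -, hη, -, -⟩ := consts_pos hA hne k
    have hBp : IsPlusHull (hullC J ρ A (lvlN k) t ω) := isPlusHull_hullC hA halive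
    have hρ₀eq : 8 * rho0K A k = lvl A k := by rw [rho0K]; ring
    have hBρ : Disjoint (ball (0 : ℂ) (8 * rho0K A k)) (hullC J ρ A (lvlN k) t ω) := by rw [hρ₀eq]; exact hball
    obtain ⟨-, -, -, hZ0, ho⟩ := good_of_clockTrunc_lt hreg hω (clockTrunc_lt_of_le_tauK ht.le)
    have hoI : oposC J ρ (lvlN k) t ω ∈ Icc (-(3 * (k : ℝ)) - 2) 0 := by
      have := habso; rw [abs_le] at this
      exact ⟨by linarith [this.1], oposC_nonpos t ω⟩
    have hid := drift_identity hBp.1 hρ₀ hBρ hJet ρ hoI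
    obtain ⟨e1, e2, e3, e4, -⟩ := jets_of_mem (J := J) (ρ := ρ) (A := A) (c := lvlN k) halive (rho0K A k)
    rw [e1, e2, e3, e4]
    have hneg : -oposC J ρ (lvlN k) t ω = drvC J ρ (lvlN k) t ω + 2 * clockTrunc J (lvlN k) t ω := by rw [ho, neg_neg]
    rw [← hneg]
    convert hid using 2
    push_cast
    ring
  · -- the one-step expansion on good paths
    filter_upwards [hgood] with ω hω
    refine ⟨fun t₁ t₂ S hτ h12 hh hW hS hI ↦ ?_⟩
    have hlt₁ := clockTrunc_lt_of_le_tauK hτ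
    obtain ⟨-, -, -, hZ1, -⟩ := good_of_clockTrunc_lt hreg hω hlt₁
    have hlt₂ : clockTrunc J (lvlN k) t₂ ω < lvlN k := by
      obtain ⟨-, -, -, -, hI₁, -⟩ := controls_of_le_tauK hτ
      calc clockTrunc J (lvlN k) t₂ ω ≤ clockTrunc J (lvlN k) t₁ ω + c0K A ρ k := by linarith
        _ < (lvlN k : ℝ) := by rw [coe_lvlN]; linarith
    obtain ⟨-, -, -, hZ2, -⟩ := good_of_clockTrunc_lt hreg hω hlt₂
    have hstep := oneStep_pathwise hAs hA hne hτ h12 hh hW hS hρ hI hZ1 hZ2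
    have h0 : (0 : ℝ) ≤ (t₂ : ℝ) - t₁ := by
      have : (t₁ : ℝ) ≤ t₂ := by exact_mod_cast h12.le
      linarith
    have hI0 : 0 ≤ clockTrunc J (lvlN k) t₂ ω - clockTrunc J (lvlN k) t₁ ω := sub_nonneg.2 (monotone_clockTrunc (lvlN k) ω h12.le)
    have hS0 : 0 ≤ S := (abs_nonneg _).trans (hW t₂ h12.le le_rfl)
    exact hstep.trans (mul_le_mul_of_nonneg_right hK4 (cellPoly_nonneg (abs_nonneg _) (by positivity) h0 (by positivity)))

/-- **`Y^{τ_k}` is a martingale, adapted, with a.s. continuous paths** ([LSW] Lemma 8.9 for the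
level-`k` localisation). [cite: LawlerSchrammWerner2003Restriction, Lemma 8.9] -/
theorem martingale_stoppedProcess_level (hAs : IsSmoothHull A) (hA : IsPlusHull A) (hne : A.Nonempty) (hρ : -2 < ρ)
    (hreg : RegularPair (8 / 3) ρ W W' J) (hgood : ∀ᵐ ω ∂preWienerMeasure, GoodPath (8 / 3) ρ O W W' J ω) (k : ℕ) :
    Martingale (stoppedProcess (Yc J ρ A (lvlN k)) (tauK J ρ hA hne k)) brownianFiltration preWienerMeasure ∧
      Adapted brownianFiltration (stoppedProcess (Yc J ρ A (lvlN k)) (tauK J ρ hA hne k)) ∧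
      ∀ᵐ ω ∂preWienerMeasure, Continuous fun r ↦ stoppedProcess (Yc J ρ A (lvlN k)) (tauK J ρ hA hne k) r ω := by
  have h𝒮 := cellScheme_level (J := J) hAs hA hne hρ hreg hgood k
  exact ⟨h𝒮.martingale_stoppedProcess, h𝒮.adapted_stoppedProcess, h𝒮.ae_continuous_stoppedProcess⟩

end SLEKappaRho

end Literature.Probability.RandomPlanarGeometry

end

/-!
## [LSW] Lemma 8.9 for SLE(8/3, ρ): the martingale extension of `M_t` (assembly)

G. F. Lawler, O. Schramm, W. Werner, *Conformal restriction: the chordal case*, J. Amer. Math.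
Soc. **16** (2003) 917–955 (**[LSW]**), §8.4: Lemma 8.9 ("`(M_t, t < T)` is a local martingale"),
Lemma 8.10 ("`M_t ≤ 1`") and the end of the proof of Thm. 8.4 ("`M_t` converges a.s. and in `L¹`
as `t → T`"). From the cell schemes of all levels (`cellScheme_level`,
`SLEKappaRhoSchemeInstance`): the processes `Y^{(k)}` of level `k` agree up to `τ_k` (locality in
the truncation level), so the single process `Yinf = limsup_k Y^{(k)}` has
`Yinf^{τ_k} = (Y^{(k)})^{τ_k}`, a bounded martingale with a.s. continuous paths for every `k`;
the localising times `τ_k` increase, and **on the good paths they exhaust `[0, T_A)`**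
(`exists_lt_tauK_of_lt_hullHitTime`: up to any `t < T_A` the true controls — alive margin,
`Φ'_{B_s}(0)`, clearance of the negative axis — are continuous and positive on the compact `[0, t]`,
the driver and the clock are bounded there, and the synthetic driver of a high level is the true
one); the frozen limit `Ȳ` of `SLEKappaRho`-free `Literature.Probability.Process.frozenLimit`
(`FrozenLocalMartingale`: Revuz–Yor Ch. IV (1.23), Ch. II (2.10)) is then the sought
**martingale extension** (`SLEKappaRho.IsMartingaleExtension`):

* `SLEKappaRho.exists_isMartingaleExtension` — for `ρ > −2`, every SLE(8/3, ρ) pair and every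
  non-empty smooth `A ∈ 𝒬₊`, `∃ M, IsMartingaleExtension ρ A O W M`.

No named facts.
-/

noncomputable section

open Set Filter Metric Function MeasureTheory
open _root_.Complex _root_.Topology
open scoped NNReal ENNReal
open Literature.Probability.Process Literature.Analysis.FunctionSpaces

namespace Literature.Probability.RandomPlanarGeometry

namespace SLEKappaRho

open Loewner

variable {J : ℝ≥0 → (ℝ≥0 → ℝ) → ℝ} {ρ : ℝ} {A : Set ℂ} {O W W' : ℝ≥0 → (ℝ≥0 → ℝ) → ℝ}

/-! ### The single process -/

/-- **`Yinf = limsup_k Y^{(k)}`**, one process for all levels. [folklore] -/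
def Yinf (J : ℝ≥0 → (ℝ≥0 → ℝ) → ℝ) (ρ : ℝ) (A : Set ℂ) (t : ℝ≥0) (ω : ℝ≥0 → ℝ) : ℝ :=
  limsup (fun k ↦ Yc J ρ A (lvlN k) t ω) atTop

/-- `Yinf ∈ [0, 1]`. [folklore] -/
theorem Yinf_mem_Icc (t : ℝ≥0) (ω : ℝ≥0 → ℝ) : Yinf J ρ A t ω ∈ Icc (0 : ℝ) 1 := by
  rw [Yinf]
  have hb : ∀ k : ℕ, Yc J ρ A (lvlN k) t ω ≤ 1 := fun k ↦ (Yc_mem_Icc _ ω).2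
  have ha : ∀ k : ℕ, 0 ≤ Yc J ρ A (lvlN k) t ω := fun k ↦ (Yc_mem_Icc _ ω).1
  have hbdd : IsBoundedUnder (· ≤ ·) atTop fun k : ℕ ↦ Yc J ρ A (lvlN k) t ω := ⟨1, eventually_map.2 (Eventually.of_forall hb)⟩
  have hbddb : IsBoundedUnder (· ≥ ·) atTop fun k : ℕ ↦ Yc J ρ A (lvlN k) t ω := ⟨0, eventually_map.2 (Eventually.of_forall ha)⟩
  exact ⟨le_limsup_of_frequently_le (Frequently.of_forall ha) hbdd, limsup_le_of_le hbddb.isCoboundedUnder_le (Eventually.of_forall hb)⟩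

variable {hA : IsPlusHull A} {hne : A.Nonempty}

/-- `lvlN` is monotone. [folklore] -/
theorem lvlN_mono : Monotone lvlN := fun k k' h ↦ by
  unfold lvlN; exact add_le_add (by exact_mod_cast h) le_rfl

/-- **Locality: up to `τ_k` all higher levels agree with level `k`.** [folklore] -/
theorem Yc_eq_of_le_tauK {k k' : ℕ} (hkk' : k ≤ k') {t : ℝ≥0} {ω : ℝ≥0 → ℝ} (ht : (t : WithTop ℝ≥0) ≤ tauK J ρ hA hne k ω) :
    Yc J ρ A (lvlN k') t ω = Yc J ρ A (lvlN k) t ω := by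
  obtain ⟨-, -, -, -, hclock, -⟩ := geometry_of_le_tauK ht
  have hk : clock J t ω ≤ ((lvlN k : ℝ≥0) : ℝ≥0∞) := hclock.trans (by rw [lvlN]; exact_mod_cast le_add_of_nonneg_right zero_le_one)
  exact ((locality_of_clock_le (ρ := ρ) hA.1 hk (lvlN_mono hkk') 0).2.2.1).symm

/-- **`Yinf = Y^{(k)}` up to `τ_k`.** [folklore] -/
theorem Yinf_eq_of_le_tauK {k : ℕ} {t : ℝ≥0} {ω : ℝ≥0 → ℝ} (ht : (t : WithTop ℝ≥0) ≤ tauK J ρ hA hne k ω) :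
    Yinf J ρ A t ω = Yc J ρ A (lvlN k) t ω := by
  have hev : ∀ᶠ k' in atTop, Yc J ρ A (lvlN k') t ω = Yc J ρ A (lvlN k) t ω := by
    filter_upwards [eventually_ge_atTop k] with k' hk'
    exact Yc_eq_of_le_tauK hk' ht
  rw [Yinf]
  exact (tendsto_const_nhds.congr' (EventuallyEq.symm hev)).limsup_eq

/-- **The stopped processes agree: `Yinf^{τ_k} = (Y^{(k)})^{τ_k}`.** [folklore] -/
theorem stoppedProcess_Yinf_eq (k : ℕ) :
    stoppedProcess (Yinf J ρ A) (tauK J ρ hA hne k) = stoppedProcess (Yc J ρ A (lvlN k)) (tauK J ρ hA hne k) := by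
  funext t ω
  simp only [stoppedProcess]
  refine Yinf_eq_of_le_tauK (hA := hA) (hne := hne) (k := k) ?_
  have hne' : min (t : WithTop ℝ≥0) (tauK J ρ hA hne k ω) ≠ ⊤ := ne_top_of_le_ne_top WithTop.coe_ne_top (min_le_left _ _)
  rw [WithTop.untopA_eq_untop hne', WithTop.coe_untop]
  exact min_le_right _ _

/-- The `τ_k` are non-decreasing in `k`. [folklore] -/
theorem monotone_tauK (ω : ℝ≥0 → ℝ) : Monotone fun k ↦ tauK J ρ hA hne k ω :=
  monotone_nat_of_le_succ fun k ↦ tauK_mono k ω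

/-! ### The localising times exhaust `[0, T_A)` on good paths -/

/-- The clearance functional is at least the distance of the slid hull from `K`. [folklore] -/
theorem sInf_image_le_clearFn {Ω : Type*} {V : Ω → ℝ≥0 → ℝ} {a : ℕ → ℂ} {K : Set ℂ} {t : ℝ≥0} {ω : Ω}
    (ha : ∀ k, a k ∈ A) :
    sInf ((fun z ↦ infDist z K) '' slidHull (V ω) A t) ≤ clearFn K a V t ω := by
  refine le_ciInf fun k ↦ csInf_le ⟨0, ?_⟩ (mem_image_of_mem _ (mem_slidHull_iff.2 ⟨a k, ha k, rfl⟩))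
  rintro _ ⟨z, -, rfl⟩; exact infDist_nonneg

/-- An alive time is strictly before `T_A` (the alive times are open to the right). [folklore] -/
theorem coe_lt_hullHitTime_of_disjoint {V : ℝ≥0 → ℝ} (hV : Continuous V) (hA' : IsStarHull A) {u : ℝ≥0}
    (h : Disjoint (closedHull V u) A) : (u : WithTop ℝ≥0) < hullHitTime V A := by
  obtain ⟨u₁, hu₁, h₁⟩ := exists_lt_disjoint (W := fun _ : Unit ↦ V) (ω := ()) hV hA' h
  exact lt_of_lt_of_le (by exact_mod_cast hu₁) (le_hullHitTime_of_disjoint h₁)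

section Exhaust

variable (hA : IsPlusHull A) (hne : Set.Nonempty A) (hOW : IsSLEKappaRhoPair (8 / 3) ρ O W)
  (hreg : RegularPair (8 / 3) ρ W W' J) {ω : ℝ≥0 → ℝ} (hgood : GoodPath (8 / 3) ρ O W W' J ω)

include hOW hreg hgood in
/-- On a good path: the true path is continuous with `W_0 = 0`, the clock is finite, and at every
time where the truncation of level `c` is inactive on `[0, t]` the synthetic driver is the true one.
[folklore] -/
theorem good_path_basic (t : ℝ≥0) :
    Continuous (fun s ↦ W s ω) ∧ W 0 ω = 0 ∧ clock J t ω ≠ ⊤ ∧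
      ∀ s, s ≤ t → clockTrunc J (lvlN 0) s ω ≤ (clock J t ω).toReal ∧
        ∀ c : ℝ≥0, (clock J t ω).toReal < c → drvC J ρ c s ω = W s ω ∧ clockTrunc J c s ω ≤ (clock J t ω).toReal := by
  have hcont : Continuous fun s ↦ W s ω := by
    have := hgood.continuous; simp_rw [hgood.eq] at this; exact this
  have hfin : clock J t ω ≠ ⊤ := by
    rw [(toReal_clock_eq_timeIntegral (fun s ↦ hreg.nonneg s ω) hgood.integrableOn_Ioc t).1]
    exact ENNReal.ofReal_ne_top
  have hcs : ∀ c s, s ≤ t → clockTrunc J c s ω ≤ (clock J t ω).toReal := fun c s hs ↦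
    ENNReal.toReal_mono hfin ((min_le_left _ _).trans (monotone_clock J ω hs))
  refine ⟨hcont, hOW.snd_zero ω, hfin, fun s hs ↦ ⟨hcs _ s hs, fun c hc ↦ ⟨?_, hcs c s hs⟩⟩⟩
  exact (good_of_clockTrunc_lt (ρ := ρ) hreg hgood ((hcs c s hs).trans_lt hc)).2.1

include hOW hreg hgood in
/-- **On a good path the localising times exhaust `[0, T_A)`**: for every `t < T_A` (the hitting
time of `A` by the closed hulls of the true path) some `τ_k` is `> t`.
[cite: LawlerSchrammWerner2003Restriction, §8.4 ("(M_t, t < T) is a local martingale")] -/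
theorem exists_lt_tauK_of_lt_hullHitTime {t : ℝ≥0} (ht : (t : WithTop ℝ≥0) < hullHitTime (fun s ↦ W s ω) A) :
    ∃ k, (t : WithTop ℝ≥0) < tauK J ρ hA hne k ω := by
  obtain ⟨hcont, hW0, hfin, hloc⟩ := good_path_basic hOW hreg hgood t
  have hsp := denseSeq_spec hA.1 hne
  set a := denseSeq hA.1 hne with ha
  -- the true path as a family, and its controls
  set V : (ℝ≥0 → ℝ) → ℝ≥0 → ℝ := fun ω s ↦ W s ω with hV
  have hVc : Continuous (V ω) := hcont
  have hV0 : V ω 0 = 0 := hW0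
  have halive : ∀ s, s ≤ t → Disjoint (closedHull (V ω) s) A := fun s hs ↦
    alive_mono hs (disjoint_closedHull_of_lt_hullHitTime ht)
  set R : ℝ≥0 → ℝ := fun s ↦ aliveFn a V s ω with hR
  set D : ℝ≥0 → ℝ := fun s ↦ derivCtl 1 A a V s ω with hD
  set C : ℝ≥0 → ℝ := fun s ↦ clearCtl 1 nonposAxis a V s ω with hC
  set f : ℝ≥0 → ℝ := fun s ↦ min (R s) (min (D s) (C s)) with hf
  have hfc : Continuous f :=
    (continuous_aliveFn (W := V) hVc hV0 hA.1 hne hsp.1 hsp.2).min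
      ((continuous_derivCtl (W := V) hVc hV0 hA.1 hne hsp.1 hsp.2 zero_le_one).min
        (continuous_clearCtl (W := V) (K := nonposAxis) hVc hV0 hA.1 hne hsp.1 hsp.2 zero_le_one))
  -- positivity of the true controls at alive times
  have hfpos : ∀ s, s ≤ t → 0 < f s := by
    intro s hs
    have hal := halive s hs
    have hRpos : 0 < R s := aliveFn_pos_of_disjoint (a := a) hVc hA.1 hne (fun k ↦ (hsp.1 k).1) hal
    have hBs : IsStarHull (slidHull (V ω) A s) := Loewner.isStarHull_slidHull_of_disjoint hVc hA.1 hal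
    have hBp : IsPlusHull (slidHull (V ω) A s) := isPlusHull_slidHull_of_disjoint hVc hV0 hA hal
    have hBne : (slidHull (V ω) A s).Nonempty := hne.image _
    have hDpos : 0 < D s := by
      simp only [hD, derivCtl, Set.indicator_of_mem (show ω ∈ {ω | Disjoint (closedHull (V ω) s) A} from hal), one_mul]
      exact lt_min (starDeriv_spec hBs).1 hRpos
    have hCpos : 0 < C s := by
      simp only [hC, clearCtl, one_mul]
      exact lt_min ((sInf_infDist_nonposAxis_pos hBp hBne).trans_le (sInf_image_le_clearFn fun k ↦ (hsp.1 k).1)) hRpos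
    exact lt_min hRpos (lt_min hDpos hCpos)
  -- the minimum of `f` on `[0, t]`
  obtain ⟨s₀, hs₀, hmin⟩ := isCompact_Icc.exists_isMinOn (s := Icc (0 : ℝ≥0) t) ⟨0, left_mem_Icc.2 bot_le⟩ hfc.continuousOn
  have hm : 0 < f s₀ := hfpos s₀ hs₀.2
  -- bound on the path
  obtain ⟨s₁, -, hmax⟩ := isCompact_Icc.exists_isMaxOn (s := Icc (0 : ℝ≥0) t) ⟨0, left_mem_Icc.2 bot_le⟩
    ((continuous_abs.comp hcont).continuousOn)
  set Bw := |W s₁ ω| with hBw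
  set BI := (clock J t ω).toReal with hBI
  -- the level
  obtain ⟨k, hk⟩ := exists_nat_gt (max (max Bw BI) (max (t : ℝ) (1 / f s₀)))
  have hkBw : Bw < k := lt_of_le_of_lt ((le_max_left _ _).trans (le_max_left _ _)) hk
  have hkBI : BI < k := lt_of_le_of_lt ((le_max_right _ _).trans (le_max_left _ _)) hk
  have hkt : (t : ℝ) < k := lt_of_le_of_lt ((le_max_left _ _).trans (le_max_right _ _)) hk
  have hkm : 1 / f s₀ < k := lt_of_le_of_lt ((le_max_right _ _).trans (le_max_right _ _)) hk
  have hk0 : (0 : ℝ) < k := lt_of_le_of_lt (by positivity) hkm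
  have hlvl : lvl A k < f s₀ := by
    refine lt_of_le_of_lt (lvl_pos_le hA hne k).2.2.1 ?_
    rw [locLevel, div_lt_iff₀ (by positivity)]
    rw [div_lt_iff₀ hm] at hkm
    nlinarith
  -- the synthetic driver of level `k` is the true path on `[0, t]`
  have hBIc : BI < ((lvlN k : ℝ≥0) : ℝ) := by rw [coe_lvlN]; linarith
  have heq : ∀ s, s ≤ t → drvPath J ρ (lvlN k) ω s = V ω s := fun s hs ↦ ((hloc s hs).2 (lvlN k) hBIc).1
  have heq' : ∀ s, s ≤ t → ∀ r, r ≤ s → V ω r = drvPath J ρ (lvlN k) ω r := fun s hs r hr ↦ (heq r (hr.trans hs)).symm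
  have hWc : Continuous (drvPath J ρ (lvlN k) ω) := continuous_drvPath ω
  obtain ⟨hcR, hcD, hcC⟩ := continuous_ctl (J := J) (ρ := ρ) (hA := hA.1) (hne := hne) (c := lvlN k) ω
  have hfle : ∀ s, s ≤ t → f s₀ ≤ f s := fun s hs ↦ hmin ⟨bot_le, hs⟩
  refine ⟨k, lt_min (lt_min (lt_min (lt_min (lt_min ?_ ?_) ?_) ?_) ?_) ?_⟩
  · refine coe_lt_hittingAfter_of_forall_lt hcR fun s hs ↦ ?_
    have h1 := hfle s hs
    have h2 : f s ≤ R s := min_le_left _ _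
    unfold ctlR
    rw [← aliveFn_congr hVc hWc (heq' s hs)]
    linarith
  · refine coe_lt_hittingAfter_of_forall_lt hcD fun s hs ↦ ?_
    have h1 := hfle s hs
    have h2 : f s ≤ D s := (min_le_right _ _).trans (min_le_left _ _)
    unfold ctlD
    rw [← derivCtl_congr hVc hWc (heq' s hs) hA.1 1]
    linarith
  · refine coe_lt_hittingAfter_of_forall_lt hcC fun s hs ↦ ?_
    have h1 := hfle s hs
    have h2 : f s ≤ C s := (min_le_right _ _).trans (min_le_right _ _)
    unfold ctlC
    rw [← clearCtl_congr hVc hWc hV0 (heq' s hs) hA.1 hsp.1 hsp.2 1]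
    linarith
  · refine coe_lt_hittingAfter_Ici_of_forall_lt (X := fun t ω ↦ |drvC J ρ (lvlN k) t ω|) (continuous_drvPath ω).abs fun s hs ↦ ?_
    have he := heq s hs
    simp only [drvPath_apply] at he
    show |drvC J ρ (lvlN k) s ω| < (k : ℝ)
    rw [he]
    exact lt_of_le_of_lt (hmax ⟨bot_le, hs⟩) hkBw
  · refine coe_lt_hittingAfter_Ici_of_forall_lt (continuous_clockTrunc _ ω) fun s hs ↦ ?_
    exact lt_of_le_of_lt ((hloc s hs).2 (lvlN k) hBIc).2 hkBI
  · have : t < lvlN k := by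
      rw [← NNReal.coe_lt_coe, coe_lvlN]; linarith
    exact_mod_cast this

include hOW hreg hgood in
/-- On a good path every `τ_k` is strictly before `T_A` (it is an alive time of the true path).
[folklore] -/
theorem tauK_lt_hullHitTime (k : ℕ) : tauK J ρ hA hne k ω < hullHitTime (fun s ↦ W s ω) A := by
  obtain ⟨T, hT⟩ := WithTop.ne_top_iff_exists.1 (tauK_ne_top (J := J) (ρ := ρ) (hA := hA) (hne := hne) k ω)
  rw [← hT]
  have hle : ((T : ℝ≥0) : WithTop ℝ≥0) ≤ tauK J ρ hA hne k ω := by rw [← hT]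
  obtain ⟨hcont, -, -, hloc⟩ := good_path_basic hOW hreg hgood T
  obtain ⟨halive, -⟩ := geometry_of_le_tauK hle
  -- the synthetic driver of level `k` is the true path on `[0, T]`
  have heq : ∀ s, s ≤ T → drvPath J ρ (lvlN k) ω s = W s ω := fun s hs ↦
    (good_of_clockTrunc_lt (ρ := ρ) hreg hgood (clockTrunc_lt_of_le_tauK (le_trans (by exact_mod_cast hs) hle))).2.1
  have halive' : Disjoint (closedHull (fun s ↦ W s ω) T) A := by
    rwa [← closedHull_eq_of_eqOn (continuous_drvPath ω) hcont heq]
  exact coe_lt_hullHitTime_of_disjoint hcont hA.1 halive'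

include hOW hreg hgood in
/-- On a good path, up to `τ_k` the formula holds: `Y^{(k)}_t = M(A_t − W_t, O_t − W_t)`.
[cite: LawlerSchrammWerner2003Restriction, §8.4 (definition of M_t)] -/
theorem Yc_eq_oneSidedM_of_le_tauK (hAs : IsSmoothHull A) (hρ : -2 < ρ) {k : ℕ} {t : ℝ≥0}
    (ht : (t : WithTop ℝ≥0) ≤ tauK J ρ hA hne k ω) :
    Yc J ρ A (lvlN k) t ω = oneSidedM ρ (slidHull (fun s ↦ W s ω) A t) (O t ω - W t ω) := by
  obtain ⟨hcont, -, -, -⟩ := good_path_basic hOW hreg hgood t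
  obtain ⟨halive, -⟩ := geometry_of_le_tauK ht
  have hgoods : ∀ s, s ≤ t → drvPath J ρ (lvlN k) ω s = W s ω := fun s hs ↦
    (good_of_clockTrunc_lt (ρ := ρ) hreg hgood (clockTrunc_lt_of_le_tauK (le_trans (by exact_mod_cast hs) ht))).2.1
  obtain ⟨h1, -, h3, -, ho⟩ := good_of_clockTrunc_lt (ρ := ρ) hreg hgood (clockTrunc_lt_of_le_tauK ht)
  -- `M ∈ [0, 1]` (Lemma 8.10), so the clamp is inactive
  have hWc : Continuous (drvPath J ρ (lvlN k) ω) := continuous_drvPath ω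
  have hBp : IsPlusHull (hullC J ρ A (lvlN k) t ω) := isPlusHull_hullC hA halive
  have hBa : IsArcHull (hullC J ρ A (lvlN k) t ω) := isArcHull_slidHull_of_disjoint hWc hAs.isArcHull hA.1.zero_notMem halive
  have hM : Mraw J ρ A (lvlN k) t ω ∈ Icc (0 : ℝ) 1 := by
    obtain ⟨hlow, hup⟩ := oneSidedM_bounds_of_isArcHull hρ hBa hBp (oposC_nonpos (J := J) (ρ := ρ) (c := lvlN k) t ω)
    rw [(jets_of_mem halive 0).2.2.2.2]
    obtain ⟨hd0, hd1, -⟩ := starDeriv_spec hBp.1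
    rw [hullDeriv_eq_starDeriv] at hlow hup
    exact ⟨(Real.rpow_nonneg hd0.le _).trans hlow, hup.trans (Real.rpow_le_one hd0.le hd1 (exponent_min_pos hρ).le)⟩
  rw [Yc_eq_of_mem hM, (jets_of_mem halive 0).2.2.2.2, hullC,
    ← slidHull_congr (W := drvPath J ρ (lvlN k)) (U := fun ω s ↦ W s ω) hWc hcont hgoods hA.1 halive, ho, h3,
    hgood.eq t, hgood.fst_eq t]
  ring_nf

end Exhaust

/-! ### The martingale extension -/

/-- **[LSW] Lemma 8.9 with Lemma 8.10 and the convergence clause: the martingale extension of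
`M_t` exists** for every SLE(8/3, ρ) pair, `ρ > −2`, and every non-empty smooth `A ∈ 𝒬₊`.
[cite: LawlerSchrammWerner2003Restriction, Lemma 8.9, Lemma 8.10 and end of the proof of Thm. 8.4 (§8.4)] -/
theorem exists_isMartingaleExtension (hρ : -2 < ρ) (hOW : IsSLEKappaRhoPair (8 / 3) ρ O W)
    (hAs : IsSmoothHull A) (hA : IsPlusHull A) (hne : A.Nonempty) :
    ∃ M, IsMartingaleExtension ρ A O W M := by
  haveI : IsProbabilityMeasure preWienerMeasure := isProbabilityMeasure_preWienerMeasure'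
  obtain ⟨W', J, hreg, hgood⟩ := hOW.exists_regularPair_goodPath (by norm_num) hρ
  set τ : ℕ → (ℝ≥0 → ℝ) → WithTop ℝ≥0 := fun k ↦ tauK J ρ hA hne k with hτ
  set Y := Yinf J ρ A with hY
  have hτmono : ∀ ω, Monotone (τ · ω) := fun ω ↦ monotone_tauK ω
  have hopt : ∀ k, IsOptionalTime brownianFiltration (τ k) := fun k ↦ (isStoppingTime_tauK hreg.progressive k).isOptionalTime
  have hlev := fun k ↦ martingale_stoppedProcess_level (J := J) hAs hA hne hρ hreg hgood k
  have hX : ∀ k, Martingale (stoppedProcess Y (τ k)) brownianFiltration preWienerMeasure := fun k ↦ by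
    rw [hY, hτ, stoppedProcess_Yinf_eq]; exact (hlev k).1
  have hC : ∀ t ω, |Y t ω| ≤ 1 := fun t ω ↦ by
    have h := Yinf_mem_Icc (J := J) (ρ := ρ) (A := A) t ω
    exact abs_le.2 ⟨by linarith [h.1], h.2⟩
  have hcont : ∀ k, ∀ᵐ ω ∂preWienerMeasure, Continuous fun t ↦ stoppedProcess Y (τ k) t ω := fun k ↦ by
    rw [hY, hτ, stoppedProcess_Yinf_eq]; exact (hlev k).2.2
  refine ⟨frozenLimit Y τ, ⟨fun t ω ↦ frozenLimit_mem_Icc (fun t ω ↦ Yinf_mem_Icc t ω) t ω,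
    martingale_frozenLimit hτmono hopt hX hC hcont, ?_, ?_, ?_⟩⟩
  · -- the formula before `T_A`
    filter_upwards [hgood] with ω hω t ht
    obtain ⟨k, hk⟩ := exists_lt_tauK_of_lt_hullHitTime hA hne hOW hreg hω ht
    rw [frozenLimit_eq_of_le hτmono hk.le, hY, Yinf_eq_of_le_tauK hk.le]
    exact Yc_eq_oneSidedM_of_le_tauK hA hne hOW hreg hω hAs hρ hk.le
  · -- frozen from `T_A < ∞` on
    filter_upwards [hgood, ae_exists_frozen hτmono hopt hX hC hcont] with ω hω hfr τ₀ hτ₀ t hτ₀t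
    obtain ⟨L, hL1, hL2, -⟩ := hfr fun k ↦ tauK_ne_top k ω
    have hlt : ∀ k, τ k ω < τ₀ := fun k ↦ by
      have := tauK_lt_hullHitTime hA hne hOW hreg hω k
      rwa [hτ₀] at this
    have hex : ∀ s : ℝ≥0, s < τ₀ → ∃ k, (s : WithTop ℝ≥0) ≤ τ k ω := fun s hs ↦ by
      obtain ⟨k, hk⟩ := exists_lt_tauK_of_lt_hullHitTime hA hne hOW hreg hω (t := s) (by rw [hτ₀]; exact_mod_cast hs)
      exact ⟨k, hk.le⟩
    have hM : frozenLimit Y τ t ω = L := hL1 t fun k ↦ (hlt k).le.trans (by exact_mod_cast hτ₀t)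
    rw [hM]
    exact hL2 τ₀ hlt hex
  · -- the limit at infinity on `{T_A = ∞}`
    filter_upwards [hgood, ae_exists_frozen hτmono hopt hX hC hcont] with ω hω hfr htop
    obtain ⟨L, -, -, hL3⟩ := hfr fun k ↦ tauK_ne_top k ω
    refine ⟨L, hL3 fun t ↦ ?_⟩
    obtain ⟨k, hk⟩ := exists_lt_tauK_of_lt_hullHitTime hA hne hOW hreg hω (t := t) (by rw [htop]; exact WithTop.coe_lt_top t)
    exact ⟨k, hk.le⟩

end SLEKappaRho

end Literature.Probability.RandomPlanarGeometry

end
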